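import Literature.Barriers.PneNP.MatchingSlackPsdRankBeyondFooling
import HarnessLib

/-!
# Every row of Edmonds' slack matrix heads a maximum psd fooling set; square-root rank `≥ 2(m−2)(m−3)`

Complement to `MatchingSlackPsdRankBeyondFooling.lean` (the all-`n` theorem `rk_psd(S_odd(K_n)) ≥ C(n/2+1, 2)`,
proved there by MINOR-LOCAL compression: patterns for the `3`-rows and the columns of its parity minor only) and
to `MatchingSlackPsdFoolingSetSharp.lean` (one triangular pattern of size `τ(m) = C(m+1,2) − 1`, whose first row
is a `3`-set up to complement). Object: the odd-cut slack matrix `S_{UM} = |δ(U) ∩ M| − 1` of the perfect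
matching polytope of `K_{2m}` (`pmOddCutSlack (2m)`, rows `OddSet (2m)`, columns `PMatch (2m)`). This file adds
what the companion does not control — the rows of size `5, 7, …, 2m−5` — and a larger parity minor:

* `exists_rowPattern` (§10): for `m ≥ 3` and EVERY odd set `U` with `3 ≤ |U| ≤ 2m − 3` there is a triangular
  pattern of size `C(m+1,2) − 2` inside the columns where the row `U` vanishes; equivalently every genuine
  Edmonds row is the head of a triangular pattern of the sharp size `C(m+1,2) − 1`. (Companion:
  `exists_rowPattern_three`, `|U| = 3` only.)
* `rank_rowFactor_add_le` / `rank_colFactor_add_le` / `rank_factors_le_two`: by GRT compression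
  [GouveiaRobinsonThomas2013, Prop. 2.6 (p06)], in ANY psd factorisation of `S` of size `K` every factor of a
  genuine row and every column factor has `rank + (C(m+1,2) − 2) ≤ K`; at the first size not excluded by the
  companion, `K = C(m+1,2)`, ALL these factors have rank `≤ 2`.
* `le_rank_of_hadamardSqrt` / `le_of_rankOne_psdFactorization` (§11): every real `N` with `N ∘ N = S` has
  `rank N ≥ 4·C(m−2,2) = 2(m−2)(m−3)` (explicit `𝔽₂`-invertible `2·(J − I)` minor on the triangles
  `{p̄, q̄, n−2}` against the columns `T(p,q)`, `blk p < blk q ≤ m−2`, both label choices); hence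
  [FawziEtAl2015, Prop. 6.2 (p18)] no psd factorisation with rank-one factors ("square-root rank") has size
  `< 2(m−2)(m−3) ≈ n²/2` (the companion's minor `{1,p,q} × N(p,q)` gives `(m−1)(m−2)`; compare
  `rank S = C(n,2) − n + 1`, `OddCutRank.rank_pmOddCutSlack`).

## The pattern family `P(m, k)` (new; labels `0, …, n−1`, blocks `B_t = {2t, 2t+1}`, `A = [1,k]`, `B = [k+1, m−2]`)
Columns are the matchings `T(p,q)` of the Sharp file (`PsdFoolingSet.TriCol`: base matching with the blocks of
`0, p, q` re-matched as `{0,p}, {1,q}, {p̄,q̄}`); generic rows are BLOCK ROWS `{1} ∪ ⋃_{t ∈ R} B_t`. The one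
computation behind everything (§2, `cc_blockRow_eq_one` / `two_le_cc_blockRow`) is the DIRECTED-CUT FORMULA
`|δ({1} ∪ B_R) ∩ T(p,q)| = 3` if `blk p ∈ R ∌ blk q`, else `1`. `P(m,k)` has size `τ(m) = C(m+1,2) − 1`, FIRST
row `{1, …, 2k+1}` (so every odd size `3, …, 2m−3` occurs as `k` runs over `[1, m−2]`) and LAST column
`T(n−1, n−2)`; in pattern order (a row vanishes on all LATER columns):
* `S1a(i)`, `i = k..m−2`: row `[1,i]`-blocks, column `T(2i, n−1)`; `S1b(i,j)`, `k+1 ≤ j < i`: row `A ∪ [j+1,i]`,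
  column `T(2i, 2j)` — the interval family on `B ∪ {∞}` with rows enlarged by `A`;
* `S2a(i)`, `i = 1..k−1`: row `[1,i]`, column `T(2i, 2k)`; `S2b(i,j)`, `1 ≤ j < i ≤ k`: row `[j+1,i]`, column
  `T(2i, 2j)` — the interval family on `A`;
* `S3(b,a)`, `b ∈ B`, `a ∈ A`: row `(A ∖ {a}) ∪ {b}`, column `T(2b, 2a)` — a DIAGONAL block;
* the tail of the Sharp file: `S4a(q) = ({q−1,q,n−2}; T(n−2,q))`, `q` odd in `[3, n−3]`; `S4b = ({0,2,n−1};
  T(n−2,n−1))`; `S4c(q) = ({1} ∪ [q+1,n−1]; T(n−1,q))`; `S4d = ({0,1,2}; T(n−1,n−2))`.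
Count `C(m−1−k,2) + C(k+1,2) − 1 + k(m−2−k) + 1 + 2m − 2 = C(m+1,2) − 1` (`card_idx`, over `ℚ`; the identity
`C(|A|+1,2) − 1 + C(|B|+1,2) + |A||B| = C(|A|+|B|+1,2) − 1` is why a first row of every size costs nothing).
The family was found in the seat by analysing the directed-cut matrix `[i ∈ R ∌ j]` (maximum triangular
pattern `C(r+1,2) − 1` on `r` blocks, any first-row size) and script-checked for `m ≤ 12`, all `k`; the proofs
are the two generic lemmas plus nine short case tables for the three special rows (§3) — no kernel `decide`.
`S_{2m}`-transport (companion's `imgOdd`/`imgPM`, `exists_imgOdd_eq`) moves the first row onto any `U`.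

Honest scope. No new psd-rank NUMBER: the companion already proves `rk_psd ≥ C(m+1,2)` for all `m ≥ 4` and
this file does not go beyond it (excluding size `C(m+1,2)` would need a handle on rank-`≤ 2` factors, which
the square-root/parity step does not provide). What is new is structural: compression on EVERY genuine row,
the rank-`≤ 2` statement for all factors at size `C(m+1,2)`, and the square-root-rank floor `2(m−2)(m−3)`.
presearch (2026-08-29; corpus `lit search --hybrid` "positive semidefinite rank lower bound perfect matching
polytope odd cut slack matrix Hadamard square root parity" → only generic book hits [Blekherman–Parrilo–Thomas
2012], [Horn–Johnson]; galaxy `psd rank of the matching polytope|semidefinite rank of the matching|square root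
rank of the slack`, all stars → one hit, Lee–Wei, *The square root rank of the correlation polytope is
exponential*, arXiv:1411.6712 — square-root rank for a DIFFERENT polytope; nothing on Edmonds' slack matrix):
the pattern family and the minor are ours [folklore-level]; the cited mechanisms are [GouveiaRobinsonThomas2013,
Prop. 2.6 / Lemma 2.4 / Ex. 2.3 (p05–p07)] and [FawziEtAl2015, Thm. 2.10 + Ex. 2.11 (p07), Prop. 6.2 (p18)],
page-confirmed in the companion files. Label: instrument — structure of near-minimal psd factorisations of the
route Target's object; nothing asymptotic beyond `Θ(n²)`. WHAT THIS IS NOT: no statement about the crux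
`TracialDecayExp20` (stmt-PneNP-19878, OPEN), no new lower bound on `rk_psd`, no P-vs-NP content.
-/

noncomputable section

open Finset Matrix Equiv

namespace Literature.Barriers.PneNP

open Literature.Combinatorics.Optimization (HasPsdFactorization HasHadamardSqrtOfRankLE FawziEtAl2015_prop62_holds
  rank_rowFactor_add_le_of_triangular rank_colFactor_add_le_of_triangular isPMOn_univ_image_map)
open Literature.Combinatorics.AssociationSchemes.CutMatchingRestriction (crossCount crossCount_image cc_eq_crossCount)
open Literature.Combinatorics.AssociationSchemes.MatchingLevelInequality
  (fpfInvolutions mem_fpfInvolutions exists_perm_fixing_image_eq exists_conj_eq)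
open Literature.Combinatorics.AssociationSchemes.HomogeneousMatchingFamilies
  (permOf edgesOf edgesOf_permOf permOf_mem_fpfInvolutions)
open PsdFoolingSet (TriCol triFun pmOddCutSlack_eq_zero_iff)
open OddCutRank (Tri cc_toOdd_add_two_mul)
open PsdRankBeyondFooling (imgOdd imgPM cc_imgOdd_imgPM pmOddCutSlack_img exists_imgOdd_eq exists_imgPM_eq
  exists_colPattern le_rank_of_hadamardSqrt_of_oddMinor')

namespace PsdRowCompression

variable {n : ℕ}

/-! ### §0 Plumbing -/

/-- Case table of the partner map of `T(p,q)` (which branch a label falls into, with the value there).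
[folklore] -/
private theorem cases' (t : TriCol n) (x : ℕ) :
    (x = 0 ∧ triFun t.p t.p' t.q t.q' x = t.p) ∨
    (x ≠ 0 ∧ x = t.p ∧ triFun t.p t.p' t.q t.q' x = 0) ∨
    (x ≠ 0 ∧ x ≠ t.p ∧ x = 1 ∧ triFun t.p t.p' t.q t.q' x = t.q) ∨
    (x ≠ 0 ∧ x ≠ t.p ∧ x ≠ 1 ∧ x = t.q ∧ triFun t.p t.p' t.q t.q' x = 1) ∨
    (x ≠ 0 ∧ x ≠ t.p ∧ x ≠ 1 ∧ x ≠ t.q ∧ x = t.p' ∧ triFun t.p t.p' t.q t.q' x = t.q') ∨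
    (x ≠ 0 ∧ x ≠ t.p ∧ x ≠ 1 ∧ x ≠ t.q ∧ x ≠ t.p' ∧ x = t.q' ∧ triFun t.p t.p' t.q t.q' x = t.p') ∨
    (x ≠ 0 ∧ x ≠ t.p ∧ x ≠ 1 ∧ x ≠ t.q ∧ x ≠ t.p' ∧ x ≠ t.q' ∧ x % 2 = 0 ∧
      triFun t.p t.p' t.q t.q' x = x + 1) ∨
    (x ≠ 0 ∧ x ≠ t.p ∧ x ≠ 1 ∧ x ≠ t.q ∧ x ≠ t.p' ∧ x ≠ t.q' ∧ x % 2 = 1 ∧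
      triFun t.p t.p' t.q t.q' x = x - 1) := by
  unfold triFun
  by_cases h0 : x = 0
  · rw [if_pos h0]; exact Or.inl ⟨h0, rfl⟩
  rw [if_neg h0]
  by_cases h1 : x = t.p
  · rw [if_pos h1]; exact Or.inr <| Or.inl ⟨h0, h1, rfl⟩
  rw [if_neg h1]
  by_cases h2 : x = 1
  · rw [if_pos h2]; exact Or.inr <| Or.inr <| Or.inl ⟨h0, h1, h2, rfl⟩
  rw [if_neg h2]
  by_cases h3 : x = t.q
  · rw [if_pos h3]; exact Or.inr <| Or.inr <| Or.inr <| Or.inl ⟨h0, h1, h2, h3, rfl⟩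
  rw [if_neg h3]
  by_cases h4 : x = t.p'
  · rw [if_pos h4]; exact Or.inr <| Or.inr <| Or.inr <| Or.inr <| Or.inl ⟨h0, h1, h2, h3, h4, rfl⟩
  rw [if_neg h4]
  by_cases h5 : x = t.q'
  · rw [if_pos h5]
    exact Or.inr <| Or.inr <| Or.inr <| Or.inr <| Or.inr <| Or.inl ⟨h0, h1, h2, h3, h4, h5, rfl⟩
  rw [if_neg h5]
  by_cases h6 : x % 2 = 0
  · rw [if_pos h6]
    exact Or.inr <| Or.inr <| Or.inr <| Or.inr <| Or.inr <| Or.inr <| Or.inl ⟨h0, h1, h2, h3, h4, h5, h6, rfl⟩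
  rw [if_neg h6]
  exact Or.inr <| Or.inr <| Or.inr <| Or.inr <| Or.inr <| Or.inr <| Or.inr
    ⟨h0, h1, h2, h3, h4, h5, by omega, rfl⟩

/-- **The column `T(p,q)`** for labels `2 ≤ p ≠ q < n` (`n` even): base matching `{01, 23, …}` with the
blocks of `0`, `p`, `q` re-matched as `{0,p}, {1,q}, {p̄,q̄}`. [folklore] -/
def col (n p q : ℕ) (h : 2 ≤ p ∧ p < n ∧ 2 ≤ q ∧ q < n ∧ p ≠ q ∧ n % 2 = 0) : TriCol n :=
  ⟨p, p + 1 - 2 * (p % 2), q, q + 1 - 2 * (q % 2), by omega⟩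

/-- The data of `col n p q`. [folklore] -/
private theorem col_data {p q : ℕ} (h : 2 ≤ p ∧ p < n ∧ 2 ≤ q ∧ q < n ∧ p ≠ q ∧ n % 2 = 0) :
    (col n p q h).p = p ∧ (col n p q h).p' = p + 1 - 2 * (p % 2) ∧ (col n p q h).q = q ∧
      (col n p q h).q' = q + 1 - 2 * (q % 2) := ⟨rfl, rfl, rfl, rfl⟩

/-! ### §1 Rows: `{1} ∪` three block-aligned intervals; triangles -/

/-- `{1} ∪ [l₁,h₁] ∪ [l₂,h₂] ∪ [l₃,h₃]` as a set of labels. [folklore] -/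
private def rowNat3 (l₁ h₁ l₂ h₂ l₃ h₃ : ℕ) : Finset ℕ := insert 1 (Icc l₁ h₁ ∪ Icc l₂ h₂ ∪ Icc l₃ h₃)

/-- Membership in `{1} ∪ [l₁,h₁] ∪ [l₂,h₂] ∪ [l₃,h₃]`. [folklore] -/
private theorem mem_rowNat3 {l₁ h₁ l₂ h₂ l₃ h₃ v : ℕ} : v ∈ rowNat3 l₁ h₁ l₂ h₂ l₃ h₃ ↔
    v = 1 ∨ (l₁ ≤ v ∧ v ≤ h₁) ∨ (l₂ ≤ v ∧ v ≤ h₂) ∨ (l₃ ≤ v ∧ v ≤ h₃) := by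
  simp only [rowNat3, mem_insert, mem_union, mem_Icc, or_assoc]

/-- Admissible interval data: block-aligned (`l` even, `h` odd), ordered, inside `[2, n)`. Empty
intervals are allowed (`h < l`). [folklore] -/
private def IvOK (n l₁ h₁ l₂ h₂ l₃ h₃ : ℕ) : Prop :=
  l₁ % 2 = 0 ∧ h₁ % 2 = 1 ∧ l₂ % 2 = 0 ∧ h₂ % 2 = 1 ∧ l₃ % 2 = 0 ∧ h₃ % 2 = 1 ∧ 2 ≤ l₁ ∧
    h₁ < l₂ ∧ h₂ < l₃ ∧ h₁ < l₃ ∧ h₃ < n ∧ h₁ < n ∧ h₂ < n ∧ n % 2 = 0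

/-- `|{1} ∪ [l₁,h₁] ∪ [l₂,h₂] ∪ [l₃,h₃]| = 1 + Σ (hᵢ + 1 − lᵢ)` for admissible data. [folklore] -/
private theorem card_rowNat3 {l₁ h₁ l₂ h₂ l₃ h₃ : ℕ} (H : IvOK n l₁ h₁ l₂ h₂ l₃ h₃) :
    (rowNat3 l₁ h₁ l₂ h₂ l₃ h₃).card = (h₁ + 1 - l₁) + (h₂ + 1 - l₂) + (h₃ + 1 - l₃) + 1 := by
  unfold IvOK at H
  have d1 : Disjoint (Icc l₁ h₁) (Icc l₂ h₂) :=
    Finset.disjoint_left.2 fun x hx hx' => by rw [mem_Icc] at hx hx'; omega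
  have d2 : Disjoint (Icc l₁ h₁ ∪ Icc l₂ h₂) (Icc l₃ h₃) :=
    Finset.disjoint_left.2 fun x hx hx' => by
      rw [mem_union, mem_Icc, mem_Icc] at hx; rw [mem_Icc] at hx'; omega
  rw [rowNat3, card_insert_of_notMem (by simp only [mem_union, mem_Icc]; omega),
    card_union_of_disjoint d2, card_union_of_disjoint d1, Nat.card_Icc, Nat.card_Icc, Nat.card_Icc]

/-- **The odd set `{1} ∪ [l₁,h₁] ∪ [l₂,h₂] ∪ [l₃,h₃]`** of `Fin n` for admissible interval data (each
block-aligned interval has even length, so the cardinality is odd). [folklore] -/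
private def genRow (n l₁ h₁ l₂ h₂ l₃ h₃ : ℕ) (H : IvOK n l₁ h₁ l₂ h₂ l₃ h₃) : OddSet n :=
  ⟨(rowNat3 l₁ h₁ l₂ h₂ l₃ h₃).attachFin (fun v hv => by
      rw [mem_rowNat3] at hv; unfold IvOK at H; omega), by
    rw [card_attachFin, card_rowNat3 H, Nat.odd_iff]
    unfold IvOK at H
    omega⟩

/-- Membership in `genRow`. [folklore] -/
private theorem mem_genRow {l₁ h₁ l₂ h₂ l₃ h₃ : ℕ} (H : IvOK n l₁ h₁ l₂ h₂ l₃ h₃) (v : Fin n) :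
    v ∈ (genRow n l₁ h₁ l₂ h₂ l₃ h₃ H).1 ↔
      ((v : ℕ) = 1 ∨ (l₁ ≤ (v : ℕ) ∧ (v : ℕ) ≤ h₁) ∨ (l₂ ≤ (v : ℕ) ∧ (v : ℕ) ≤ h₂) ∨
        (l₃ ≤ (v : ℕ) ∧ (v : ℕ) ≤ h₃)) := by
  show v ∈ (rowNat3 l₁ h₁ l₂ h₂ l₃ h₃).attachFin _ ↔ _
  rw [mem_attachFin, mem_rowNat3]

/-- The cardinality of `genRow`. [folklore] -/
private theorem card_genRow {l₁ h₁ l₂ h₂ l₃ h₃ : ℕ} (H : IvOK n l₁ h₁ l₂ h₂ l₃ h₃) :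
    (genRow n l₁ h₁ l₂ h₂ l₃ h₃ H).1.card = (h₁ + 1 - l₁) + (h₂ + 1 - l₂) + (h₃ + 1 - l₃) + 1 := by
  show ((rowNat3 l₁ h₁ l₂ h₂ l₃ h₃).attachFin _).card = _
  rw [card_attachFin, card_rowNat3 H]

/-! ### §2 Crossing numbers of block rows against `T(p,q)` (the directed-cut formula)

A *block row* is a label set `U ∌ 0`, `U ∋ 1`, closed under the partner map `x ↦ x xor 1` on labels
`≥ 2` (membership predicate `Q`). Against the column `T(p,q)` (`p, q` in different blocks) such a row has
`|δ(U) ∩ T(p,q)| = 1` unless `p ∈ U ∌ q`, in which case `1 ↦ q` and `p ↦ 0` both leave `U`. -/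

section Generic

variable (t : TriCol n) (U : OddSet n) (Q : ℕ → Prop)

/-- Partner-closure transported along the `TriCol` encoding `x' + 2 (x mod 2) = x + 1`. [folklore] -/
private theorem q_partner (hQb : ∀ x, 2 ≤ x → x % 2 = 0 → (Q x ↔ Q (x + 1))) {x x' : ℕ} (hx : 2 ≤ x)
    (hx' : x' + 2 * (x % 2) = x + 1) : Q x ↔ Q x' := by
  rcases Nat.mod_two_eq_zero_or_one x with h0 | h1
  · have e : x' = x + 1 := by omega
    rw [e]; exact hQb x hx h0
  · have e : x = x' + 1 := by omega
    rw [e]; exact (hQb x' (by omega) (by omega)).symm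

/-- The eight-branch uniqueness argument shared by the tight cases: a label `v ∈ U` matched outside `U`
is `0`-adjacent (`v = p`), `1`, or one of `p̄, q̄`; the remaining labels stay inside their block. [folklore] -/
private theorem exit_cases (hQ1 : Q 1) (hQ0 : ¬Q 0)
    (hQb : ∀ x, 2 ≤ x → x % 2 = 0 → (Q x ↔ Q (x + 1))) {v : ℕ} (hPv : Q v)
    (hTv : ¬Q (triFun t.p t.p' t.q t.q' v)) :
    (v = t.p ∧ Q t.p) ∨ (v = 1 ∧ ¬Q t.q) ∨ (v = t.p' ∧ v ≠ t.q ∧ Q t.p ∧ ¬Q t.q) ∨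
      (v = t.q' ∧ v ≠ t.p ∧ Q t.q ∧ ¬Q t.p) := by
  obtain ⟨o1, o2, o3, o4, o5, o6, o7, o8⟩ := t.ok
  have hpp : Q t.p ↔ Q t.p' := q_partner Q hQb o1 o6
  have hqq : Q t.q ↔ Q t.q' := q_partner Q hQb o3 o7
  rcases cases' t v with ⟨hv, hT⟩ | ⟨-, hv, hT⟩ | ⟨-, -, hv, hT⟩ | ⟨-, -, -, hv, hT⟩ |
      ⟨-, hvp, -, hvq, hv, hT⟩ | ⟨-, hvp, -, hvq, -, hv, hT⟩ | ⟨hv0, -, -, -, -, -, hpar, hT⟩ |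
      ⟨-, -, hv1, -, -, -, hpar, hT⟩ <;> rw [hT] at hTv
  · subst hv; exact absurd hPv hQ0
  · subst hv; exact Or.inl ⟨rfl, hPv⟩
  · subst hv; exact Or.inr (Or.inl ⟨rfl, hTv⟩)
  · exact absurd hQ1 hTv
  · subst hv
    exact Or.inr (Or.inr (Or.inl ⟨rfl, hvq, hpp.2 hPv, fun h => hTv (hqq.1 h)⟩))
  · subst hv
    exact Or.inr (Or.inr (Or.inr ⟨rfl, hvp, hqq.2 hPv, fun h => hTv (hpp.1 h)⟩))
  · exact absurd ((hQb v (by omega) hpar).1 hPv) hTv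
  · have e : v - 1 + 1 = v := by omega
    have h := hQb (v - 1) (by omega) (by omega)
    rw [e] at h
    exact absurd (h.2 hPv) hTv

/-- **Tight case of the directed-cut formula.** For a block row `U` and a column `T(p,q)` with `p, q`
in different blocks: unless `p ∈ U ∌ q`, exactly one label of `U` is matched outside `U`, so
`|δ(U) ∩ T(p,q)| = 1`. [cite: Rothvoss2017, §2 (PDF p. 5)] -/
theorem cc_blockRow_eq_one (hU : ∀ v : Fin n, v ∈ U.1 ↔ Q v) (hQ1 : Q 1) (hQ0 : ¬Q 0)
    (hQb : ∀ x, 2 ≤ x → x % 2 = 0 → (Q x ↔ Q (x + 1))) (hpq : t.p / 2 ≠ t.q / 2)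
    (h : ¬Q t.p ∨ Q t.q) : cc U t.toPMatch = 1 := by
  obtain ⟨o1, o2, o3, o4, o5, o6, o7, o8⟩ := t.ok
  have hpp : Q t.p ↔ Q t.p' := q_partner Q hQb o1 o6
  have hqq : Q t.q ↔ Q t.q' := q_partner Q hQb o3 o7
  by_cases hp : Q t.p
  · -- then `q ∈ U`: exit `p` (matched to `0`)
    have hq : Q t.q := h.resolve_left (not_not.2 hp)
    refine t.cc_eq_one_of_unique U Q hU t.p o2 hp ?_ ?_
    · have := cases' t t.p
      have e : triFun t.p t.p' t.q t.q' t.p = 0 := by omega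
      rw [e]; exact hQ0
    · intro v hv hPv hTv
      rcases exit_cases t Q hQ1 hQ0 hQb hPv hTv with ⟨h1, -⟩ | ⟨-, h2⟩ | ⟨-, -, -, h2⟩ | ⟨-, -, -, h2⟩
      · exact h1
      · exact absurd hq h2
      · exact absurd hq h2
      · exact absurd hp h2
  · by_cases hq : Q t.q
    · -- exit `q̄` (matched to `p̄`)
      refine t.cc_eq_one_of_unique U Q hU t.q' (by omega) (hqq.1 hq) ?_ ?_
      · have := cases' t t.q'
        have e : triFun t.p t.p' t.q t.q' t.q' = t.p' := by omega
        rw [e]; exact fun h' => hp (hpp.2 h')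
      · intro v hv hPv hTv
        rcases exit_cases t Q hQ1 hQ0 hQb hPv hTv with ⟨-, h2⟩ | ⟨-, h2⟩ | ⟨-, -, h2, -⟩ | ⟨h1, -⟩
        · exact absurd h2 hp
        · exact absurd hq h2
        · exact absurd h2 hp
        · exact h1
    · -- exit `1` (matched to `q`)
      refine t.cc_eq_one_of_unique U Q hU 1 (by omega) hQ1 ?_ ?_
      · have := cases' t 1
        have e : triFun t.p t.p' t.q t.q' 1 = t.q := by omega
        rw [e]; exact hq
      · intro v hv hPv hTv
        rcases exit_cases t Q hQ1 hQ0 hQb hPv hTv with ⟨-, h2⟩ | ⟨h1, -⟩ | ⟨-, -, h2, -⟩ | ⟨-, -, h2, -⟩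
        · exact absurd h2 hp
        · exact h1
        · exact absurd h2 hp
        · exact absurd h2 hq

/-- **Tight case, two-block columns.** Against `T(p, p̄)` (only the blocks of `0` and `p` re-matched:
`0 ↦ p`, `1 ↦ p̄`) every block row is tight. [cite: Rothvoss2017, §2 (PDF p. 5)] -/
theorem cc_blockRow_eq_one₂ (hU : ∀ v : Fin n, v ∈ U.1 ↔ Q v) (hQ1 : Q 1) (hQ0 : ¬Q 0)
    (hQb : ∀ x, 2 ≤ x → x % 2 = 0 → (Q x ↔ Q (x + 1))) (hpq : t.q = t.p') :
    cc U t.toPMatch = 1 := by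
  obtain ⟨o1, o2, o3, o4, o5, o6, o7, o8⟩ := t.ok
  have hpp : Q t.p ↔ Q t.p' := q_partner Q hQb o1 o6
  by_cases hp : Q t.p
  · -- exit `p`
    refine t.cc_eq_one_of_unique U Q hU t.p o2 hp ?_ ?_
    · have := cases' t t.p
      have e : triFun t.p t.p' t.q t.q' t.p = 0 := by omega
      rw [e]; exact hQ0
    · intro v hv hPv hTv
      rcases exit_cases t Q hQ1 hQ0 hQb hPv hTv with ⟨h1, -⟩ | ⟨-, h2⟩ | ⟨-, -, -, h2⟩ | ⟨-, -, -, h2⟩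
      · exact h1
      · rw [hpq] at h2; exact absurd (hpp.1 hp) h2
      · rw [hpq] at h2; exact absurd (hpp.1 hp) h2
      · exact absurd hp h2
  · -- exit `1`
    refine t.cc_eq_one_of_unique U Q hU 1 (by omega) hQ1 ?_ ?_
    · have := cases' t 1
      have e : triFun t.p t.p' t.q t.q' 1 = t.q := by omega
      rw [e, hpq]; exact fun h' => hp (hpp.2 h')
    · intro v hv hPv hTv
      rcases exit_cases t Q hQ1 hQ0 hQb hPv hTv with ⟨-, h2⟩ | ⟨h1, -⟩ | ⟨-, -, h2, -⟩ | ⟨-, -, h2, -⟩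
      · exact absurd h2 hp
      · exact h1
      · exact absurd h2 hp
      · rw [hpq] at h2; exact absurd h2 (fun h' => hp (hpp.2 h'))

/-- **Non-tight case of the directed-cut formula**: if `p ∈ U ∌ q` then `1` (matched to `q`) and `p`
(matched to `0`) both leave `U`, so `|δ(U) ∩ T(p,q)| ≥ 2`. [cite: Rothvoss2017, §2 (PDF p. 5)] -/
theorem two_le_cc_blockRow (hU : ∀ v : Fin n, v ∈ U.1 ↔ Q v) (hQ1 : Q 1) (hQ0 : ¬Q 0)
    (hp : Q t.p) (hq : ¬Q t.q) : 2 ≤ cc U t.toPMatch := by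
  obtain ⟨o1, o2, o3, o4, o5, o6, o7, o8⟩ := t.ok
  refine t.two_le_cc_of_two U Q hU 1 t.p (by omega) o2 (by omega) hQ1 hp ?_ ?_
  · have := cases' t 1
    have e : triFun t.p t.p' t.q t.q' 1 = t.q := by omega
    rw [e]; exact hq
  · have := cases' t t.p
    have e : triFun t.p t.p' t.q t.q' t.p = 0 := by omega
    rw [e]; exact hQ0

end Generic

/-- The membership predicate of `genRow` is a block-row predicate: contains `1`, not `0`, and is
closed under partners on labels `≥ 2` (block-aligned intervals). [folklore] -/
private theorem genRow_blockPred {l₁ h₁ l₂ h₂ l₃ h₃ : ℕ} (H : IvOK n l₁ h₁ l₂ h₂ l₃ h₃) :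
    (fun v : ℕ => v = 1 ∨ (l₁ ≤ v ∧ v ≤ h₁) ∨ (l₂ ≤ v ∧ v ≤ h₂) ∨ (l₃ ≤ v ∧ v ≤ h₃)) 1 ∧
    ¬(fun v : ℕ => v = 1 ∨ (l₁ ≤ v ∧ v ≤ h₁) ∨ (l₂ ≤ v ∧ v ≤ h₂) ∨ (l₃ ≤ v ∧ v ≤ h₃)) 0 ∧
    ∀ x, 2 ≤ x → x % 2 = 0 →
      ((fun v : ℕ => v = 1 ∨ (l₁ ≤ v ∧ v ≤ h₁) ∨ (l₂ ≤ v ∧ v ≤ h₂) ∨ (l₃ ≤ v ∧ v ≤ h₃)) x ↔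
        (fun v : ℕ => v = 1 ∨ (l₁ ≤ v ∧ v ≤ h₁) ∨ (l₂ ≤ v ∧ v ≤ h₂) ∨ (l₃ ≤ v ∧ v ≤ h₃)) (x + 1)) := by
  unfold IvOK at H
  refine ⟨Or.inl rfl, by simp only; omega, fun x hx hpar => ?_⟩
  simp only
  omega

/-! ### §3 Triangle rows and the three special rows of the tail -/

/-- **The ordered triangle `(a, b, c)` of labels** as an element of `Tri n`. [folklore] -/
private def tri (n a b c : ℕ) (h : a < n ∧ b < n ∧ c < n ∧ a ≠ b ∧ a ≠ c ∧ b ≠ c) : Tri n :=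
  ⟨(⟨a, h.1⟩, ⟨b, h.2.1⟩, ⟨c, h.2.2.1⟩), by
    refine ⟨?_, ?_, ?_⟩ <;> simp only [ne_eq, Fin.mk.injEq] <;> omega⟩

/-- Membership in the triangle row `{a, b, c}`. [folklore] -/
private theorem mem_tri {a b c : ℕ} (h : a < n ∧ b < n ∧ c < n ∧ a ≠ b ∧ a ≠ c ∧ b ≠ c) (v : Fin n) :
    v ∈ (tri n a b c h).toOdd.1 ↔ ((v : ℕ) = a ∨ (v : ℕ) = b ∨ (v : ℕ) = c) := by
  show v ∈ ({(⟨a, h.1⟩ : Fin n), ⟨b, h.2.1⟩, ⟨c, h.2.2.1⟩} : Finset (Fin n)) ↔ _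
  simp only [mem_insert, mem_singleton, Fin.ext_iff]

/-- The triangle row has three elements. [folklore] -/
private theorem card_tri {a b c : ℕ} (h : a < n ∧ b < n ∧ c < n ∧ a ≠ b ∧ a ≠ c ∧ b ≠ c) :
    (tri n a b c h).toOdd.1.card = 3 := by
  show ({(⟨a, h.1⟩ : Fin n), ⟨b, h.2.1⟩, ⟨c, h.2.2.1⟩} : Finset (Fin n)).card = 3
  refine Finset.card_eq_three.2 ⟨⟨a, h.1⟩, ⟨b, h.2.1⟩, ⟨c, h.2.2.1⟩, ?_, ?_, ?_, rfl⟩ <;>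
    simp only [ne_eq, Fin.mk.injEq] <;> omega

section Special

variable (t : TriCol n) (U : OddSet n)

/-- Row `B(q) = {q−1, q, n−2}` against `T(n−2, q')`, `q < q'` — exit `n−2`. [folklore] -/
private theorem cc_rowB_colB {q q' : ℕ} (ht : t.p + 2 = n ∧ t.p' + 1 = n ∧ t.q = q' ∧ t.q' + 1 = q')
    (hU : ∀ v : Fin n, v ∈ U.1 ↔ ((v : ℕ) = q - 1 ∨ (v : ℕ) = q ∨ (v : ℕ) = n - 2))
    (H : q % 2 = 1 ∧ q' % 2 = 1 ∧ 3 ≤ q ∧ q < q' ∧ q' + 3 ≤ n ∧ n % 2 = 0) : cc U t.toPMatch = 1 := by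
  refine t.cc_eq_one_of_unique U (fun v => v = q - 1 ∨ v = q ∨ v = n - 2) hU (n - 2)
    (by omega) (by omega) ?_ ?_
  · have := cases' t (n - 2); omega
  · intro v hv hPv hTv; have := cases' t v; omega

/-- Row `B(q)` against `T(n−2, n−1)` — exit `n−2`. [folklore] -/
private theorem cc_rowB_colY0 {q : ℕ} (ht : t.p + 2 = n ∧ t.p' + 1 = n ∧ t.q + 1 = n ∧ t.q' + 2 = n)
    (hU : ∀ v : Fin n, v ∈ U.1 ↔ ((v : ℕ) = q - 1 ∨ (v : ℕ) = q ∨ (v : ℕ) = n - 2))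
    (H : q % 2 = 1 ∧ 3 ≤ q ∧ q + 3 ≤ n ∧ n % 2 = 0) : cc U t.toPMatch = 1 := by
  refine t.cc_eq_one_of_unique U (fun v => v = q - 1 ∨ v = q ∨ v = n - 2) hU (n - 2)
    (by omega) (by omega) ?_ ?_
  · have := cases' t (n - 2); omega
  · intro v hv hPv hTv; have := cases' t v; omega

/-- Row `B(q)` against `T(n−1, q')` — exit `q` if `q' = q`, else `n−2`. [folklore] -/
private theorem cc_rowB_colC {q q' : ℕ} (ht : t.p + 1 = n ∧ t.p' + 2 = n ∧ t.q = q' ∧ t.q' + 1 = q')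
    (hU : ∀ v : Fin n, v ∈ U.1 ↔ ((v : ℕ) = q - 1 ∨ (v : ℕ) = q ∨ (v : ℕ) = n - 2))
    (H : q % 2 = 1 ∧ q' % 2 = 1 ∧ 3 ≤ q ∧ q + 3 ≤ n ∧ 3 ≤ q' ∧ q' + 3 ≤ n ∧ n % 2 = 0) :
    cc U t.toPMatch = 1 := by
  by_cases hq : q' = q
  · refine t.cc_eq_one_of_unique U (fun v => v = q - 1 ∨ v = q ∨ v = n - 2) hU q
      (by omega) (by omega) ?_ ?_
    · have := cases' t q; omega
    · intro v hv hPv hTv; have := cases' t v; omega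
  · refine t.cc_eq_one_of_unique U (fun v => v = q - 1 ∨ v = q ∨ v = n - 2) hU (n - 2)
      (by omega) (by omega) ?_ ?_
    · have := cases' t (n - 2); omega
    · intro v hv hPv hTv; have := cases' t v; omega

/-- Row `B(q)` against `T(n−1, n−2)` — exit `n−2`. [folklore] -/
private theorem cc_rowB_colX0 {q : ℕ} (ht : t.p + 1 = n ∧ t.p' + 2 = n ∧ t.q + 2 = n ∧ t.q' + 1 = n)
    (hU : ∀ v : Fin n, v ∈ U.1 ↔ ((v : ℕ) = q - 1 ∨ (v : ℕ) = q ∨ (v : ℕ) = n - 2))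
    (H : q % 2 = 1 ∧ 3 ≤ q ∧ q + 3 ≤ n ∧ n % 2 = 0) : cc U t.toPMatch = 1 := by
  refine t.cc_eq_one_of_unique U (fun v => v = q - 1 ∨ v = q ∨ v = n - 2) hU (n - 2)
    (by omega) (by omega) ?_ ?_
  · have := cases' t (n - 2); omega
  · intro v hv hPv hTv; have := cases' t v; omega

/-- Row `B(q)` against its own column `T(n−2, q)` — `n−2 ↦ 0` and `q ↦ 1` leave. [folklore] -/
private theorem two_le_cc_B {q : ℕ} (ht : t.p + 2 = n ∧ t.p' + 1 = n ∧ t.q = q ∧ t.q' + 1 = q)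
    (hU : ∀ v : Fin n, v ∈ U.1 ↔ ((v : ℕ) = q - 1 ∨ (v : ℕ) = q ∨ (v : ℕ) = n - 2))
    (H : q % 2 = 1 ∧ 3 ≤ q ∧ q + 3 ≤ n ∧ n % 2 = 0) : 2 ≤ cc U t.toPMatch := by
  refine t.two_le_cc_of_two U (fun v => v = q - 1 ∨ v = q ∨ v = n - 2) hU q (n - 2)
    (by omega) (by omega) (by omega) (by omega) (by omega) ?_ ?_
  · have := cases' t q; omega
  · have := cases' t (n - 2); omega

/-- Row `Y0 = {0, 2, n−1}` against `T(n−1, q')` — exit `2`. [folklore] -/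
private theorem cc_rowY0_colC {q' : ℕ} (ht : t.p + 1 = n ∧ t.p' + 2 = n ∧ t.q = q' ∧ t.q' + 1 = q')
    (hU : ∀ v : Fin n, v ∈ U.1 ↔ ((v : ℕ) = 0 ∨ (v : ℕ) = 2 ∨ (v : ℕ) = n - 1))
    (H : q' % 2 = 1 ∧ 3 ≤ q' ∧ q' + 3 ≤ n ∧ n % 2 = 0) : cc U t.toPMatch = 1 := by
  refine t.cc_eq_one_of_unique U (fun v => v = 0 ∨ v = 2 ∨ v = n - 1) hU 2
    (by omega) (by omega) ?_ ?_
  · have := cases' t 2; omega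
  · intro v hv hPv hTv; have := cases' t v; omega

/-- Row `Y0` against `T(n−1, n−2)` — exit `2`. [folklore] -/
private theorem cc_rowY0_colX0 (ht : t.p + 1 = n ∧ t.p' + 2 = n ∧ t.q + 2 = n ∧ t.q' + 1 = n)
    (hU : ∀ v : Fin n, v ∈ U.1 ↔ ((v : ℕ) = 0 ∨ (v : ℕ) = 2 ∨ (v : ℕ) = n - 1))
    (H : 6 ≤ n ∧ n % 2 = 0) : cc U t.toPMatch = 1 := by
  refine t.cc_eq_one_of_unique U (fun v => v = 0 ∨ v = 2 ∨ v = n - 1) hU 2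
    (by omega) (by omega) ?_ ?_
  · have := cases' t 2; omega
  · intro v hv hPv hTv; have := cases' t v; omega

/-- Row `Y0` against its own column `T(n−2, n−1)` — `0` and `n−1` leave. [folklore] -/
private theorem two_le_cc_Y0 (ht : t.p + 2 = n ∧ t.p' + 1 = n ∧ t.q + 1 = n ∧ t.q' + 2 = n)
    (hU : ∀ v : Fin n, v ∈ U.1 ↔ ((v : ℕ) = 0 ∨ (v : ℕ) = 2 ∨ (v : ℕ) = n - 1))
    (H : 6 ≤ n ∧ n % 2 = 0) : 2 ≤ cc U t.toPMatch := by
  refine t.two_le_cc_of_two U (fun v => v = 0 ∨ v = 2 ∨ v = n - 1) hU 0 (n - 1)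
    (by omega) (by omega) (by omega) (by omega) (by omega) ?_ ?_
  · have := cases' t 0; omega
  · have := cases' t (n - 1); omega

/-- Row `X0 = {0, 1, 2}` against its own column `T(n−1, n−2)` — `0` and `1` leave. [folklore] -/
private theorem two_le_cc_X0 (ht : t.p + 1 = n ∧ t.p' + 2 = n ∧ t.q + 2 = n ∧ t.q' + 1 = n)
    (hU : ∀ v : Fin n, v ∈ U.1 ↔ ((v : ℕ) = 0 ∨ (v : ℕ) = 1 ∨ (v : ℕ) = 2))
    (H : 6 ≤ n ∧ n % 2 = 0) : 2 ≤ cc U t.toPMatch := by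
  refine t.two_le_cc_of_two U (fun v => v = 0 ∨ v = 1 ∨ v = 2) hU 0 1
    (by omega) (by omega) (by omega) (by omega) (by omega) ?_ ?_
  · have := cases' t 0; omega
  · have := cases' t 1; omega

end Special

/-! ### §4 The rows of the minor: triangles `{p̄, q̄, n−2}` against the columns `T(p', q')` -/

section Minor

variable (t : TriCol n) (U : OddSet n)

/-- The triangle `{p̄, q̄, n−2}` is tight for its own column `T(p,q)` (`p̄ ↦ q̄`, `q̄ ↦ p̄` stay inside;
only `n−2 ↦ n−1` leaves). [folklore] -/
private theorem cc_minor_diag {p pb q qb : ℕ} (ht : t.p = p ∧ t.p' = pb ∧ t.q = q ∧ t.q' = qb)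
    (hU : ∀ v : Fin n, v ∈ U.1 ↔ ((v : ℕ) = pb ∨ (v : ℕ) = qb ∨ (v : ℕ) = n - 2))
    (H : 2 ≤ p ∧ p + 3 ≤ n ∧ 2 ≤ q ∧ q + 3 ≤ n ∧ p / 2 ≠ q / 2 ∧ n % 2 = 0) :
    cc U t.toPMatch = 1 := by
  obtain ⟨o1, o2, o3, o4, o5, o6, o7, o8⟩ := t.ok
  refine t.cc_eq_one_of_unique U (fun v => v = pb ∨ v = qb ∨ v = n - 2) hU (n - 2)
    (by omega) (by omega) ?_ ?_
  · have := cases' t (n - 2); omega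
  · intro v hv hPv hTv; have := cases' t v; omega

/-- The triangle `{p̄, q̄, n−2}` against ANOTHER column `T(p', q')` of the minor (blocks of `p', q'`
ordered and `≤ m−2`, `(p', q') ≠ (p, q)`): `n−2` and `p̄` are both matched outside. [folklore] -/
private theorem two_le_cc_minor {p pb q qb : ℕ}
    (hU : ∀ v : Fin n, v ∈ U.1 ↔ ((v : ℕ) = pb ∨ (v : ℕ) = qb ∨ (v : ℕ) = n - 2))
    (H : 2 ≤ p ∧ p + 3 ≤ n ∧ 2 ≤ q ∧ q + 3 ≤ n ∧ p / 2 < q / 2 ∧ pb + 2 * (p % 2) = p + 1 ∧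
      qb + 2 * (q % 2) = q + 1 ∧ n % 2 = 0)
    (H' : t.p + 3 ≤ n ∧ t.q + 3 ≤ n ∧ t.p / 2 < t.q / 2) (hne : t.p ≠ p ∨ t.q ≠ q) :
    2 ≤ cc U t.toPMatch := by
  obtain ⟨o1, o2, o3, o4, o5, o6, o7, o8⟩ := t.ok
  refine t.two_le_cc_of_two U (fun v => v = pb ∨ v = qb ∨ v = n - 2) hU (n - 2) pb
    (by omega) (by omega) (by omega) (by omega) (by omega) ?_ ?_
  · have := cases' t (n - 2); omega
  · have := cases' t pb; omega

end Minor

/-! ### §5 Packaging of the generic lemmas for interval rows -/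

section GenPack

variable (t : TriCol n) (U : OddSet n) {l₁ h₁ l₂ h₂ l₃ h₃ : ℕ}

/-- Tightness of an interval block row against `T(p,q)` (three-block or two-block column), from the
directed-cut formula. [folklore] -/
private theorem gen_cc_eq_one (H : IvOK n l₁ h₁ l₂ h₂ l₃ h₃)
    (hU : ∀ v : Fin n, v ∈ U.1 ↔ ((v : ℕ) = 1 ∨ (l₁ ≤ (v : ℕ) ∧ (v : ℕ) ≤ h₁) ∨
      (l₂ ≤ (v : ℕ) ∧ (v : ℕ) ≤ h₂) ∨ (l₃ ≤ (v : ℕ) ∧ (v : ℕ) ≤ h₃)))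
    (hcol : t.p / 2 ≠ t.q / 2 ∨ t.q = t.p')
    (h : ¬(t.p = 1 ∨ (l₁ ≤ t.p ∧ t.p ≤ h₁) ∨ (l₂ ≤ t.p ∧ t.p ≤ h₂) ∨ (l₃ ≤ t.p ∧ t.p ≤ h₃)) ∨
      (t.q = 1 ∨ (l₁ ≤ t.q ∧ t.q ≤ h₁) ∨ (l₂ ≤ t.q ∧ t.q ≤ h₂) ∨ (l₃ ≤ t.q ∧ t.q ≤ h₃))) :
    cc U t.toPMatch = 1 := by
  obtain ⟨hQ1, hQ0, hQb⟩ := genRow_blockPred (n := n) H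
  by_cases h2 : t.q = t.p'
  · exact cc_blockRow_eq_one₂ t U
      (fun v : ℕ => v = 1 ∨ (l₁ ≤ v ∧ v ≤ h₁) ∨ (l₂ ≤ v ∧ v ≤ h₂) ∨ (l₃ ≤ v ∧ v ≤ h₃)) hU hQ1 hQ0 hQb h2
  · exact cc_blockRow_eq_one t U
      (fun v : ℕ => v = 1 ∨ (l₁ ≤ v ∧ v ≤ h₁) ∨ (l₂ ≤ v ∧ v ≤ h₂) ∨ (l₃ ≤ v ∧ v ≤ h₃)) hU hQ1 hQ0 hQb
      (hcol.resolve_right h2) h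

/-- Non-tightness of an interval block row against `T(p,q)` with `p ∈ U ∌ q`. [folklore] -/
private theorem gen_two_le_cc (H : IvOK n l₁ h₁ l₂ h₂ l₃ h₃)
    (hU : ∀ v : Fin n, v ∈ U.1 ↔ ((v : ℕ) = 1 ∨ (l₁ ≤ (v : ℕ) ∧ (v : ℕ) ≤ h₁) ∨
      (l₂ ≤ (v : ℕ) ∧ (v : ℕ) ≤ h₂) ∨ (l₃ ≤ (v : ℕ) ∧ (v : ℕ) ≤ h₃)))
    (hp : t.p = 1 ∨ (l₁ ≤ t.p ∧ t.p ≤ h₁) ∨ (l₂ ≤ t.p ∧ t.p ≤ h₂) ∨ (l₃ ≤ t.p ∧ t.p ≤ h₃))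
    (hq : ¬(t.q = 1 ∨ (l₁ ≤ t.q ∧ t.q ≤ h₁) ∨ (l₂ ≤ t.q ∧ t.q ≤ h₂) ∨ (l₃ ≤ t.q ∧ t.q ≤ h₃))) :
    2 ≤ cc U t.toPMatch := by
  obtain ⟨hQ1, hQ0, -⟩ := genRow_blockPred (n := n) H
  exact two_le_cc_blockRow t U
    (fun v : ℕ => v = 1 ∨ (l₁ ≤ v ∧ v ≤ h₁) ∨ (l₂ ≤ v ∧ v ≤ h₂) ∨ (l₃ ≤ v ∧ v ≤ h₃)) hU hQ1 hQ0 hp hq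

end GenPack

/-! ### §6 The index set of the pattern `P(m, k)`: nine families, `C(m+1, 2) − 1` in all

Indices are triples `(tag, i, j)`; the pattern order is the lexicographic order of the triples.
Parameters: `m ≥ 3` (`n = 2m`), `1 ≤ k ≤ m − 2` (the first row is `{1, …, 2k+1}`); blocks
`B_t = {2t, 2t+1}`, `A = {1..k}`, `B = {k+1..m−2}`. -/

variable {m k : ℕ}

/-- Sigma pairs shifted: `(b, a) ↦ (tag, c + b, c + a)` is injective. [folklore] -/
private theorem sigmaShift_injective (tag c : ℕ) :
    Function.Injective (fun x : (Σ _ : ℕ, ℕ) => (tag, c + x.1, c + x.2)) := by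
  rintro ⟨b, a⟩ ⟨b', a'⟩ h
  simp only [Prod.mk.injEq] at h
  obtain ⟨-, h1, h2⟩ := h
  have hb : b = b' := by omega
  have ha : a = a' := by omega
  subst hb; subst ha; rfl

/-- `S1a(i)`, `k ≤ i ≤ m−2`: index `(1, i, 0)`. [folklore] -/
private def idx1a (m k : ℕ) : Finset (ℕ × ℕ × ℕ) := (range (m - 1 - k)).image fun i => (1, k + i, 0)
/-- `S1b(i,j)`, `k+1 ≤ j < i ≤ m−2`: index `(1, i, j)`. [folklore] -/
private def idx1b (m k : ℕ) : Finset (ℕ × ℕ × ℕ) :=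
  ((range (m - 2 - k)).sigma fun b => range b).map ⟨_, sigmaShift_injective 1 (k + 1)⟩
/-- `S2a(i)`, `1 ≤ i ≤ k−1`: index `(2, i, 0)`. [folklore] -/
private def idx2a (k : ℕ) : Finset (ℕ × ℕ × ℕ) := (range (k - 1)).image fun i => (2, 1 + i, 0)
/-- `S2b(i,j)`, `1 ≤ j < i ≤ k`: index `(2, i, j)`. [folklore] -/
private def idx2b (k : ℕ) : Finset (ℕ × ℕ × ℕ) :=
  ((range k).sigma fun b => range b).map ⟨_, sigmaShift_injective 2 1⟩
/-- `S3(b,a)`, `b ∈ B`, `a ∈ A`: index `(3, b, a)`. [folklore] -/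
private def idx3 (m k : ℕ) : Finset (ℕ × ℕ × ℕ) :=
  (range (m - 2 - k) ×ˢ range k).image fun x => (3, k + 1 + x.1, 1 + x.2)
/-- `S4a(q)`, `q` odd, `3 ≤ q ≤ n−3`: index `(4, q, 0)`. [folklore] -/
private def idx4a (m : ℕ) : Finset (ℕ × ℕ × ℕ) := (range (m - 2)).image fun c => (4, 2 * c + 3, 0)
/-- `S4b`: index `(5, 0, 0)`. [folklore] -/
private def idx4b : Finset (ℕ × ℕ × ℕ) := {(5, 0, 0)}
/-- `S4c(q)`, `q` odd, `3 ≤ q ≤ n−3`: index `(6, q, 0)`. [folklore] -/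
private def idx4c (m : ℕ) : Finset (ℕ × ℕ × ℕ) := (range (m - 2)).image fun c => (6, 2 * c + 3, 0)
/-- `S4d`: index `(7, 0, 0)`. [folklore] -/
private def idx4d : Finset (ℕ × ℕ × ℕ) := {(7, 0, 0)}

/-- The index set of `P(m, k)`. [folklore] -/
private def idx (m k : ℕ) : Finset (ℕ × ℕ × ℕ) :=
  idx1a m k ∪ idx1b m k ∪ idx2a k ∪ idx2b k ∪ idx3 m k ∪ idx4a m ∪ idx4b ∪ idx4c m ∪ idx4d

/-- The nine shapes of an index (as arithmetic conditions on the triple). [folklore] -/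
private def Shape (m k : ℕ) (x : ℕ × ℕ × ℕ) : Prop :=
  (x.1 = 1 ∧ k ≤ x.2.1 ∧ x.2.1 + 2 ≤ m ∧ x.2.2 = 0) ∨
  (x.1 = 1 ∧ k + 1 ≤ x.2.2 ∧ x.2.2 < x.2.1 ∧ x.2.1 + 2 ≤ m) ∨
  (x.1 = 2 ∧ 1 ≤ x.2.1 ∧ x.2.1 + 1 ≤ k ∧ x.2.2 = 0) ∨
  (x.1 = 2 ∧ 1 ≤ x.2.2 ∧ x.2.2 < x.2.1 ∧ x.2.1 ≤ k) ∨
  (x.1 = 3 ∧ k + 1 ≤ x.2.1 ∧ x.2.1 + 2 ≤ m ∧ 1 ≤ x.2.2 ∧ x.2.2 ≤ k) ∨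
  (x.1 = 4 ∧ x.2.1 % 2 = 1 ∧ 3 ≤ x.2.1 ∧ x.2.1 + 3 ≤ 2 * m ∧ x.2.2 = 0) ∨
  (x.1 = 5 ∧ x.2.1 = 0 ∧ x.2.2 = 0) ∨
  (x.1 = 6 ∧ x.2.1 % 2 = 1 ∧ 3 ≤ x.2.1 ∧ x.2.1 + 3 ≤ 2 * m ∧ x.2.2 = 0) ∨
  (x.1 = 7 ∧ x.2.1 = 0 ∧ x.2.2 = 0)

/-- Every index has one of the nine shapes. [folklore] -/
private theorem shape_of_mem {x : ℕ × ℕ × ℕ} (hx : x ∈ idx m k) : Shape m k x := by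
  obtain ⟨tg, i, j⟩ := x
  unfold Shape
  dsimp only
  simp only [idx, mem_union] at hx
  rcases hx with (((((((h | h) | h) | h) | h) | h) | h) | h) | h
  · rw [idx1a, mem_image] at h
    obtain ⟨i', hi, h⟩ := h
    rw [mem_range] at hi
    simp only [Prod.mk.injEq] at h
    obtain ⟨h1, h2, h3⟩ := h
    exact Or.inl ⟨h1.symm, by omega, by omega, h3.symm⟩
  · rw [idx1b, mem_map] at h
    obtain ⟨y, hy, h⟩ := h
    rw [mem_sigma, mem_range, mem_range] at hy
    simp only [Function.Embedding.coeFn_mk, Prod.mk.injEq] at h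
    obtain ⟨h1, h2, h3⟩ := h
    exact Or.inr (Or.inl ⟨h1.symm, by omega, by omega, by omega⟩)
  · rw [idx2a, mem_image] at h
    obtain ⟨i', hi, h⟩ := h
    rw [mem_range] at hi
    simp only [Prod.mk.injEq] at h
    obtain ⟨h1, h2, h3⟩ := h
    exact Or.inr (Or.inr (Or.inl ⟨h1.symm, by omega, by omega, h3.symm⟩))
  · rw [idx2b, mem_map] at h
    obtain ⟨y, hy, h⟩ := h
    rw [mem_sigma, mem_range, mem_range] at hy
    simp only [Function.Embedding.coeFn_mk, Prod.mk.injEq] at h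
    obtain ⟨h1, h2, h3⟩ := h
    exact Or.inr (Or.inr (Or.inr (Or.inl ⟨h1.symm, by omega, by omega, by omega⟩)))
  · rw [idx3, mem_image] at h
    obtain ⟨y, hy, h⟩ := h
    rw [mem_product, mem_range, mem_range] at hy
    simp only [Prod.mk.injEq] at h
    obtain ⟨h1, h2, h3⟩ := h
    exact Or.inr (Or.inr (Or.inr (Or.inr (Or.inl ⟨h1.symm, by omega, by omega, by omega, by omega⟩))))
  · rw [idx4a, mem_image] at h
    obtain ⟨c, hc, h⟩ := h
    rw [mem_range] at hc
    simp only [Prod.mk.injEq] at h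
    obtain ⟨h1, h2, h3⟩ := h
    exact Or.inr (Or.inr (Or.inr (Or.inr (Or.inr (Or.inl
      ⟨h1.symm, by omega, by omega, by omega, h3.symm⟩)))))
  · rw [idx4b, mem_singleton, Prod.mk.injEq, Prod.mk.injEq] at h
    obtain ⟨h1, h2, h3⟩ := h
    exact Or.inr (Or.inr (Or.inr (Or.inr (Or.inr (Or.inr (Or.inl ⟨h1, h2, h3⟩))))))
  · rw [idx4c, mem_image] at h
    obtain ⟨c, hc, h⟩ := h
    rw [mem_range] at hc
    simp only [Prod.mk.injEq] at h
    obtain ⟨h1, h2, h3⟩ := h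
    exact Or.inr (Or.inr (Or.inr (Or.inr (Or.inr (Or.inr (Or.inr (Or.inl
      ⟨h1.symm, by omega, by omega, by omega, h3.symm⟩)))))))
  · rw [idx4d, mem_singleton, Prod.mk.injEq, Prod.mk.injEq] at h
    obtain ⟨h1, h2, h3⟩ := h
    exact Or.inr (Or.inr (Or.inr (Or.inr (Or.inr (Or.inr (Or.inr (Or.inr ⟨h1, h2, h3⟩)))))))

/-- The first index `(1, k, 0)` lies in the index set. [folklore] -/
private theorem first_mem (hk : 1 ≤ k ∧ k + 2 ≤ m) : (1, k, 0) ∈ idx m k := by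
  simp only [idx, mem_union]
  refine Or.inl (Or.inl (Or.inl (Or.inl (Or.inl (Or.inl (Or.inl (Or.inl ?_)))))))
  rw [idx1a, mem_image]
  exact ⟨0, by rw [mem_range]; omega, by simp⟩

/-- The last index `(7, 0, 0)` lies in the index set. [folklore] -/
private theorem last_mem : (7, 0, 0) ∈ idx m k := by
  simp only [idx, mem_union, idx4d, mem_singleton, or_true]

/-- `2 · C(t, 2) = t (t − 1)` written additively: `|Σ_{b<t} [0,b)| = C(t,2)`. [folklore] -/
private theorem card_sigma_range (t : ℕ) : ((range t).sigma fun b => range b).card = t.choose 2 := by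
  rw [card_sigma]
  simp only [card_range]
  have h := sum_range_id_mul_two t
  rw [Nat.choose_two_right]
  omega

/-- **`|P(m,k)| = C(m+1, 2) − 1`.** [folklore] -/
private theorem card_idx (hk : 1 ≤ k ∧ k + 2 ≤ m) : (idx m k).card + 1 = (m + 1).choose 2 := by
  -- the nine pieces are pairwise disjoint (different tags / zero vs nonzero last coordinate)
  have c1a : (idx1a m k).card = m - 1 - k := by
    rw [idx1a, card_image_of_injective _ (fun a b h => by simp only [Prod.mk.injEq] at h; omega),
      card_range]
  have c1b : (idx1b m k).card = (m - 2 - k).choose 2 := by rw [idx1b, card_map, card_sigma_range]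
  have c2a : (idx2a k).card = k - 1 := by
    rw [idx2a, card_image_of_injective _ (fun a b h => by simp only [Prod.mk.injEq] at h; omega),
      card_range]
  have c2b : (idx2b k).card = k.choose 2 := by rw [idx2b, card_map, card_sigma_range]
  have c3 : (idx3 m k).card = (m - 2 - k) * k := by
    rw [idx3, card_image_of_injective _ (fun a b h => by
      simp only [Prod.mk.injEq] at h; exact Prod.ext (by omega) (by omega)), card_product, card_range,
      card_range]
  have c4a : (idx4a m).card = m - 2 := by
    rw [idx4a, card_image_of_injective _ (fun a b h => by simp only [Prod.mk.injEq] at h; omega),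
      card_range]
  have c4c : (idx4c m).card = m - 2 := by
    rw [idx4c, card_image_of_injective _ (fun a b h => by simp only [Prod.mk.injEq] at h; omega),
      card_range]
  -- shapes of members of each piece, for disjointness
  have m1a : ∀ x ∈ idx1a m k, x.1 = 1 ∧ x.2.2 = 0 := by
    intro x h; rw [idx1a, mem_image] at h; obtain ⟨i, -, rfl⟩ := h; exact ⟨rfl, rfl⟩
  have m1b : ∀ x ∈ idx1b m k, x.1 = 1 ∧ x.2.2 ≠ 0 := by
    intro x h; rw [idx1b, mem_map] at h; obtain ⟨⟨b, a⟩, -, rfl⟩ := h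
    exact ⟨rfl, by simp only [Function.Embedding.coeFn_mk]; omega⟩
  have m2a : ∀ x ∈ idx2a k, x.1 = 2 ∧ x.2.2 = 0 := by
    intro x h; rw [idx2a, mem_image] at h; obtain ⟨i, -, rfl⟩ := h; exact ⟨rfl, rfl⟩
  have m2b : ∀ x ∈ idx2b k, x.1 = 2 ∧ x.2.2 ≠ 0 := by
    intro x h; rw [idx2b, mem_map] at h; obtain ⟨⟨b, a⟩, -, rfl⟩ := h
    exact ⟨rfl, by simp only [Function.Embedding.coeFn_mk]; omega⟩
  have m3 : ∀ x ∈ idx3 m k, x.1 = 3 := by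
    intro x h; rw [idx3, mem_image] at h; obtain ⟨y, -, rfl⟩ := h; rfl
  have m4a : ∀ x ∈ idx4a m, x.1 = 4 := by
    intro x h; rw [idx4a, mem_image] at h; obtain ⟨c, -, rfl⟩ := h; rfl
  have m4b : ∀ x ∈ idx4b, x.1 = 5 := by
    intro x h; rw [idx4b, mem_singleton] at h; subst h; rfl
  have m4c : ∀ x ∈ idx4c m, x.1 = 6 := by
    intro x h; rw [idx4c, mem_image] at h; obtain ⟨c, -, rfl⟩ := h; rfl
  have m4d : ∀ x ∈ idx4d, x.1 = 7 := by
    intro x h; rw [idx4d, mem_singleton] at h; subst h; rfl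
  have d1 : Disjoint (idx1a m k) (idx1b m k) := disjoint_left.2 fun x h h' => by
    have := m1a x h; have := m1b x h'; omega
  have d2 : Disjoint (idx1a m k ∪ idx1b m k) (idx2a k) := disjoint_left.2 fun x h h' => by
    have := m2a x h'
    rcases mem_union.1 h with h | h
    · have := m1a x h; omega
    · have := m1b x h; omega
  have d3 : Disjoint (idx1a m k ∪ idx1b m k ∪ idx2a k) (idx2b k) := disjoint_left.2 fun x h h' => by
    have := m2b x h'
    rcases mem_union.1 h with h | h
    · rcases mem_union.1 h with h | h
      · have := m1a x h; omega
      · have := m1b x h; omega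
    · have := m2a x h; omega
  have tag12 : ∀ x ∈ idx1a m k ∪ idx1b m k ∪ idx2a k ∪ idx2b k, x.1 ≤ 2 := by
    intro x h
    rcases mem_union.1 h with h | h
    · rcases mem_union.1 h with h | h
      · rcases mem_union.1 h with h | h
        · have := m1a x h; omega
        · have := m1b x h; omega
      · have := m2a x h; omega
    · have := m2b x h; omega
  have d4 : Disjoint (idx1a m k ∪ idx1b m k ∪ idx2a k ∪ idx2b k) (idx3 m k) :=
    disjoint_left.2 fun x h h' => by have := tag12 x h; have := m3 x h'; omega
  have tag3 : ∀ x ∈ idx1a m k ∪ idx1b m k ∪ idx2a k ∪ idx2b k ∪ idx3 m k, x.1 ≤ 3 := by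
    intro x h
    rcases mem_union.1 h with h | h
    · have := tag12 x h; omega
    · have := m3 x h; omega
  have d5 : Disjoint (idx1a m k ∪ idx1b m k ∪ idx2a k ∪ idx2b k ∪ idx3 m k) (idx4a m) :=
    disjoint_left.2 fun x h h' => by have := tag3 x h; have := m4a x h'; omega
  have tag4 : ∀ x ∈ idx1a m k ∪ idx1b m k ∪ idx2a k ∪ idx2b k ∪ idx3 m k ∪ idx4a m, x.1 ≤ 4 := by
    intro x h
    rcases mem_union.1 h with h | h
    · have := tag3 x h; omega
    · have := m4a x h; omega
  have d6 : Disjoint (idx1a m k ∪ idx1b m k ∪ idx2a k ∪ idx2b k ∪ idx3 m k ∪ idx4a m) idx4b :=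
    disjoint_left.2 fun x h h' => by have := tag4 x h; have := m4b x h'; omega
  have tag5 : ∀ x ∈ idx1a m k ∪ idx1b m k ∪ idx2a k ∪ idx2b k ∪ idx3 m k ∪ idx4a m ∪ idx4b,
      x.1 ≤ 5 := by
    intro x h
    rcases mem_union.1 h with h | h
    · have := tag4 x h; omega
    · have := m4b x h; omega
  have d7 : Disjoint (idx1a m k ∪ idx1b m k ∪ idx2a k ∪ idx2b k ∪ idx3 m k ∪ idx4a m ∪ idx4b)
      (idx4c m) :=
    disjoint_left.2 fun x h h' => by have := tag5 x h; have := m4c x h'; omega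
  have tag6 : ∀ x ∈ idx1a m k ∪ idx1b m k ∪ idx2a k ∪ idx2b k ∪ idx3 m k ∪ idx4a m ∪ idx4b ∪
      idx4c m, x.1 ≤ 6 := by
    intro x h
    rcases mem_union.1 h with h | h
    · have := tag5 x h; omega
    · have := m4c x h; omega
  have d8 : Disjoint (idx1a m k ∪ idx1b m k ∪ idx2a k ∪ idx2b k ∪ idx3 m k ∪ idx4a m ∪ idx4b ∪
      idx4c m) idx4d :=
    disjoint_left.2 fun x h h' => by have := tag6 x h; have := m4d x h'; omega
  rw [idx, card_union_of_disjoint d8, card_union_of_disjoint d7, card_union_of_disjoint d6,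
    card_union_of_disjoint d5, card_union_of_disjoint d4, card_union_of_disjoint d3,
    card_union_of_disjoint d2, card_union_of_disjoint d1, c1a, c1b, c2a, c2b, c3, c4a, idx4b,
    card_singleton, c4c, idx4d, card_singleton]
  -- the binomial identity, over `ℚ`
  obtain ⟨a, rfl⟩ : ∃ a, m = k + a + 2 := ⟨m - k - 2, by omega⟩
  obtain ⟨k', rfl⟩ : ∃ k', k = k' + 1 := ⟨k - 1, by omega⟩
  have e1 : k' + 1 + a + 2 - 1 - (k' + 1) = a + 1 := by omega
  have e2 : k' + 1 + a + 2 - 2 - (k' + 1) = a := by omega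
  have e3 : k' + 1 - 1 = k' := by omega
  have e4 : k' + 1 + a + 2 - 2 = k' + a + 1 := by omega
  rw [e1, e2, e3, e4]
  have hq : ((a + 1 + a.choose 2 + k' + (k' + 1).choose 2 + a * (k' + 1) + (k' + a + 1) + 1 +
      (k' + a + 1) + 1 + 1 : ℕ) : ℚ) = (((k' + 1 + a + 2 + 1).choose 2 : ℕ) : ℚ) := by
    push_cast [Nat.cast_choose_two]
    ring
  exact_mod_cast hq

/-- The code of an index: three digits in base `2m + 8` (lexicographic order of the triple).
[folklore] -/
private def code (m : ℕ) (x : ℕ × ℕ × ℕ) : ℕ := (x.1 * (2 * m + 8) + x.2.1) * (2 * m + 8) + x.2.2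

/-- All three coordinates of an index are `< 2m + 8`. [folklore] -/
private theorem lt_of_shape (hk : 1 ≤ k ∧ k + 2 ≤ m) {x : ℕ × ℕ × ℕ} (hx : Shape m k x) :
    x.1 < 2 * m + 8 ∧ x.2.1 < 2 * m + 8 ∧ x.2.2 < 2 * m + 8 := by
  unfold Shape at hx; omega

/-- Two-digit codes `i·N + j` (`j, j' < N`): `<` is lexicographic. [folklore] -/
private theorem digit_lt {N i j i' j' : ℕ} (hj' : j' < N)
    (h : i * N + j < i' * N + j') : i < i' ∨ (i = i' ∧ j < j') := by
  rcases lt_trichotomy i i' with hlt | rfl | hgt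
  · exact Or.inl hlt
  · exact Or.inr ⟨rfl, by omega⟩
  · exfalso
    have h1 : (i' + 1) * N ≤ i * N := Nat.mul_le_mul_right _ (Nat.succ_le_of_lt hgt)
    rw [Nat.succ_mul] at h1
    omega

/-- Two-digit codes are injective. [folklore] -/
private theorem digit_inj {N i j i' j' : ℕ} (hj : j < N) (hj' : j' < N)
    (h : i * N + j = i' * N + j') : i = i' ∧ j = j' := by
  rcases lt_trichotomy i i' with hlt | rfl | hgt
  · exfalso
    have h1 : (i + 1) * N ≤ i' * N := Nat.mul_le_mul_right _ (Nat.succ_le_of_lt hlt)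
    rw [Nat.succ_mul] at h1
    omega
  · exact ⟨rfl, by omega⟩
  · exfalso
    have h1 : (i' + 1) * N ≤ i * N := Nat.mul_le_mul_right _ (Nat.succ_le_of_lt hgt)
    rw [Nat.succ_mul] at h1
    omega

/-- The code is injective on the index set. [folklore] -/
private theorem code_injOn (hk : 1 ≤ k ∧ k + 2 ≤ m) : Set.InjOn (code m) ↑(idx m k) := by
  intro x hx y hy hxy
  have hx' := lt_of_shape hk (shape_of_mem (mem_coe.1 hx))
  have hy' := lt_of_shape hk (shape_of_mem (mem_coe.1 hy))
  obtain ⟨h1, h2⟩ := digit_inj (N := 2 * m + 8) hx'.2.2 hy'.2.2 hxy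
  obtain ⟨h3, h4⟩ := digit_inj (N := 2 * m + 8) hx'.2.1 hy'.2.1 h1
  exact Prod.ext h3 (Prod.ext h4 h2)

/-- A smaller code means a lexicographically smaller triple. [folklore] -/
private theorem lex_of_code_lt (hk : 1 ≤ k ∧ k + 2 ≤ m) {x y : ℕ × ℕ × ℕ} (hx : Shape m k x)
    (hy : Shape m k y) (h : code m x < code m y) :
    x.1 < y.1 ∨ (x.1 = y.1 ∧ (x.2.1 < y.2.1 ∨ (x.2.1 = y.2.1 ∧ x.2.2 < y.2.2))) := by
  have hx' := lt_of_shape hk hx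
  have hy' := lt_of_shape hk hy
  rcases digit_lt (N := 2 * m + 8) hy'.2.2 h with h1 | ⟨h1, h2⟩
  · rcases digit_lt (N := 2 * m + 8) hy'.2.1 h1 with h3 | ⟨h3, h4⟩
    · exact Or.inl h3
    · exact Or.inr ⟨h3, Or.inl h4⟩
  · obtain ⟨h3, h4⟩ := digit_inj (N := 2 * m + 8) hx'.2.1 hy'.2.1 h1
    exact Or.inr ⟨h3, Or.inr ⟨h4, h2⟩⟩

/-- Two-digit codes: a smaller leading digit gives a smaller code. [folklore] -/
private theorem digit_lt_of_lt {N i j i' j' : ℕ} (hj : j < N) (h : i < i') : i * N + j < i' * N + j' := by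
  have h1 : (i + 1) * N ≤ i' * N := Nat.mul_le_mul_right _ (Nat.succ_le_of_lt h)
  rw [Nat.succ_mul] at h1
  omega

/-- A lexicographically smaller triple (coordinates `< 2m+8`) has a smaller code. [folklore] -/
private theorem code_lt_of_lex {x y : ℕ × ℕ × ℕ} (hx : x.2.1 < 2 * m + 8 ∧ x.2.2 < 2 * m + 8)
    (h : x.1 < y.1 ∨ (x.1 = y.1 ∧ (x.2.1 < y.2.1 ∨ (x.2.1 = y.2.1 ∧ x.2.2 < y.2.2)))) :
    code m x < code m y := by
  unfold code
  rcases h with h | ⟨h1, h | ⟨h2, h3⟩⟩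
  · exact digit_lt_of_lt hx.2 (digit_lt_of_lt hx.1 h)
  · rw [h1]; exact digit_lt_of_lt hx.2 (by omega)
  · rw [h1, h2]; omega

/-- The first index `(1, k, 0)` has the smallest code. [folklore] -/
private theorem code_first_lt (hk : 1 ≤ k ∧ k + 2 ≤ m) {y : ℕ × ℕ × ℕ} (hy : y ∈ idx m k)
    (hne : y ≠ (1, k, 0)) : code m (1, k, 0) < code m y := by
  have hs := shape_of_mem hy
  unfold Shape at hs
  have hne' : ¬(y.1 = 1 ∧ y.2.1 = k ∧ y.2.2 = 0) := by
    rintro ⟨h1, h2, h3⟩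
    exact hne (Prod.ext h1 (Prod.ext h2 h3))
  exact code_lt_of_lex (by dsimp only; omega) (by dsimp only; omega)

/-- The last index `(7, 0, 0)` has the largest code. [folklore] -/
private theorem code_lt_last (hk : 1 ≤ k ∧ k + 2 ≤ m) {x : ℕ × ℕ × ℕ} (hx : x ∈ idx m k)
    (hne : x ≠ (7, 0, 0)) : code m x < code m (7, 0, 0) := by
  have hs := shape_of_mem hx
  have hx' := lt_of_shape hk hs
  unfold Shape at hs
  have hne' : ¬(x.1 = 7 ∧ x.2.1 = 0 ∧ x.2.2 = 0) := by
    rintro ⟨h1, h2, h3⟩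
    exact hne (Prod.ext h1 (Prod.ext h2 h3))
  exact code_lt_of_lex ⟨hx'.2.1, hx'.2.2⟩ (by dsimp only; omega)

/-! ### §7 Rows and columns of the pattern `P(m, k)` -/

/-- **Row of `P(m,k)` at index `x`** (shape by shape; junk row `{0,1,2}` off the index set).
[folklore] -/
def rowOf (m k : ℕ) (hk : 1 ≤ k ∧ k + 2 ≤ m) (x : ℕ × ℕ × ℕ) : OddSet (2 * m) :=
  if h : x.1 = 1 ∧ k ≤ x.2.1 ∧ x.2.1 + 2 ≤ m ∧ x.2.2 = 0 then
    genRow (2 * m) 2 (2 * x.2.1 + 1) (2 * x.2.1 + 2) (2 * x.2.1 + 1) (2 * x.2.1 + 2) (2 * x.2.1 + 1)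
      (by unfold IvOK; omega)
  else if h : x.1 = 1 ∧ k + 1 ≤ x.2.2 ∧ x.2.2 < x.2.1 ∧ x.2.1 + 2 ≤ m then
    genRow (2 * m) 2 (2 * k + 1) (2 * x.2.2 + 2) (2 * x.2.1 + 1) (2 * x.2.1 + 2) (2 * x.2.1 + 1)
      (by unfold IvOK; omega)
  else if h : x.1 = 2 ∧ 1 ≤ x.2.1 ∧ x.2.1 + 1 ≤ k ∧ x.2.2 = 0 then
    genRow (2 * m) 2 (2 * x.2.1 + 1) (2 * x.2.1 + 2) (2 * x.2.1 + 1) (2 * x.2.1 + 2) (2 * x.2.1 + 1)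
      (by unfold IvOK; omega)
  else if h : x.1 = 2 ∧ 1 ≤ x.2.2 ∧ x.2.2 < x.2.1 ∧ x.2.1 ≤ k then
    genRow (2 * m) (2 * x.2.2 + 2) (2 * x.2.1 + 1) (2 * x.2.1 + 2) (2 * x.2.1 + 1) (2 * x.2.1 + 2)
      (2 * x.2.1 + 1) (by unfold IvOK; omega)
  else if h : x.1 = 3 ∧ k + 1 ≤ x.2.1 ∧ x.2.1 + 2 ≤ m ∧ 1 ≤ x.2.2 ∧ x.2.2 ≤ k then
    genRow (2 * m) 2 (2 * x.2.2 - 1) (2 * x.2.2 + 2) (2 * k + 1) (2 * x.2.1) (2 * x.2.1 + 1)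
      (by unfold IvOK; omega)
  else if h : x.1 = 4 ∧ x.2.1 % 2 = 1 ∧ 3 ≤ x.2.1 ∧ x.2.1 + 3 ≤ 2 * m ∧ x.2.2 = 0 then
    (tri (2 * m) (x.2.1 - 1) x.2.1 (2 * m - 2) (by omega)).toOdd
  else if h : x.1 = 5 ∧ x.2.1 = 0 ∧ x.2.2 = 0 then
    (tri (2 * m) 0 2 (2 * m - 1) (by omega)).toOdd
  else if h : x.1 = 6 ∧ x.2.1 % 2 = 1 ∧ 3 ≤ x.2.1 ∧ x.2.1 + 3 ≤ 2 * m ∧ x.2.2 = 0 then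
    genRow (2 * m) (x.2.1 + 1) (2 * m - 1) (2 * m) (2 * m - 1) (2 * m) (2 * m - 1)
      (by unfold IvOK; omega)
  else (tri (2 * m) 0 1 2 (by omega)).toOdd

/-- **Column of `P(m,k)` at index `x`** (shape by shape; junk column `T(n−1, n−2)` off the index set).
[folklore] -/
def colOf (m k : ℕ) (hk : 1 ≤ k ∧ k + 2 ≤ m) (x : ℕ × ℕ × ℕ) : TriCol (2 * m) :=
  if h : x.1 = 1 ∧ k ≤ x.2.1 ∧ x.2.1 + 2 ≤ m ∧ x.2.2 = 0 then
    col (2 * m) (2 * x.2.1) (2 * m - 1) (by omega)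
  else if h : x.1 = 1 ∧ k + 1 ≤ x.2.2 ∧ x.2.2 < x.2.1 ∧ x.2.1 + 2 ≤ m then
    col (2 * m) (2 * x.2.1) (2 * x.2.2) (by omega)
  else if h : x.1 = 2 ∧ 1 ≤ x.2.1 ∧ x.2.1 + 1 ≤ k ∧ x.2.2 = 0 then
    col (2 * m) (2 * x.2.1) (2 * k) (by omega)
  else if h : x.1 = 2 ∧ 1 ≤ x.2.2 ∧ x.2.2 < x.2.1 ∧ x.2.1 ≤ k then
    col (2 * m) (2 * x.2.1) (2 * x.2.2) (by omega)
  else if h : x.1 = 3 ∧ k + 1 ≤ x.2.1 ∧ x.2.1 + 2 ≤ m ∧ 1 ≤ x.2.2 ∧ x.2.2 ≤ k then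
    col (2 * m) (2 * x.2.1) (2 * x.2.2) (by omega)
  else if h : x.1 = 4 ∧ x.2.1 % 2 = 1 ∧ 3 ≤ x.2.1 ∧ x.2.1 + 3 ≤ 2 * m ∧ x.2.2 = 0 then
    col (2 * m) (2 * m - 2) x.2.1 (by omega)
  else if h : x.1 = 5 ∧ x.2.1 = 0 ∧ x.2.2 = 0 then
    col (2 * m) (2 * m - 2) (2 * m - 1) (by omega)
  else if h : x.1 = 6 ∧ x.2.1 % 2 = 1 ∧ 3 ≤ x.2.1 ∧ x.2.1 + 3 ≤ 2 * m ∧ x.2.2 = 0 then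
    col (2 * m) (2 * m - 1) x.2.1 (by omega)
  else col (2 * m) (2 * m - 1) (2 * m - 2) (by omega)

section Shapes

variable (hk : 1 ≤ k ∧ k + 2 ≤ m) {x : ℕ × ℕ × ℕ}

/-- Row `S1a(i) = {1} ∪ [2, 2i+1]`. [folklore] -/
private theorem rowOf_1a (hs : x.1 = 1 ∧ k ≤ x.2.1 ∧ x.2.1 + 2 ≤ m ∧ x.2.2 = 0) (v : Fin (2 * m)) :
    v ∈ (rowOf m k hk x).1 ↔ ((v : ℕ) = 1 ∨ (2 ≤ (v : ℕ) ∧ (v : ℕ) ≤ 2 * x.2.1 + 1) ∨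
      (2 * x.2.1 + 2 ≤ (v : ℕ) ∧ (v : ℕ) ≤ 2 * x.2.1 + 1) ∨
      (2 * x.2.1 + 2 ≤ (v : ℕ) ∧ (v : ℕ) ≤ 2 * x.2.1 + 1)) := by
  rw [rowOf, dif_pos hs]; exact mem_genRow _ v

/-- Column `S1a(i) = T(2i, n−1)`. [folklore] -/
private theorem colOf_1a (hs : x.1 = 1 ∧ k ≤ x.2.1 ∧ x.2.1 + 2 ≤ m ∧ x.2.2 = 0) :
    (colOf m k hk x).p = 2 * x.2.1 ∧ (colOf m k hk x).p' = 2 * x.2.1 + 1 ∧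
      (colOf m k hk x).q = 2 * m - 1 ∧ (colOf m k hk x).q' = 2 * m - 2 := by
  rw [colOf, dif_pos hs]; refine ⟨rfl, ?_, rfl, ?_⟩ <;> simp only [col] <;> omega

/-- Row `S1b(i,j) = {1} ∪ [2, 2k+1] ∪ [2j+2, 2i+1]`. [folklore] -/
private theorem rowOf_1b (hs : x.1 = 1 ∧ k + 1 ≤ x.2.2 ∧ x.2.2 < x.2.1 ∧ x.2.1 + 2 ≤ m)
    (v : Fin (2 * m)) :
    v ∈ (rowOf m k hk x).1 ↔ ((v : ℕ) = 1 ∨ (2 ≤ (v : ℕ) ∧ (v : ℕ) ≤ 2 * k + 1) ∨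
      (2 * x.2.2 + 2 ≤ (v : ℕ) ∧ (v : ℕ) ≤ 2 * x.2.1 + 1) ∨
      (2 * x.2.1 + 2 ≤ (v : ℕ) ∧ (v : ℕ) ≤ 2 * x.2.1 + 1)) := by
  rw [rowOf, dif_neg (by omega), dif_pos hs]; exact mem_genRow _ v

/-- Column `S1b(i,j) = T(2i, 2j)`. [folklore] -/
private theorem colOf_1b (hs : x.1 = 1 ∧ k + 1 ≤ x.2.2 ∧ x.2.2 < x.2.1 ∧ x.2.1 + 2 ≤ m) :
    (colOf m k hk x).p = 2 * x.2.1 ∧ (colOf m k hk x).p' = 2 * x.2.1 + 1 ∧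
      (colOf m k hk x).q = 2 * x.2.2 ∧ (colOf m k hk x).q' = 2 * x.2.2 + 1 := by
  rw [colOf, dif_neg (by omega), dif_pos hs]; refine ⟨rfl, ?_, rfl, ?_⟩ <;> simp only [col] <;> omega

/-- Row `S2a(i) = {1} ∪ [2, 2i+1]`. [folklore] -/
private theorem rowOf_2a (hs : x.1 = 2 ∧ 1 ≤ x.2.1 ∧ x.2.1 + 1 ≤ k ∧ x.2.2 = 0) (v : Fin (2 * m)) :
    v ∈ (rowOf m k hk x).1 ↔ ((v : ℕ) = 1 ∨ (2 ≤ (v : ℕ) ∧ (v : ℕ) ≤ 2 * x.2.1 + 1) ∨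
      (2 * x.2.1 + 2 ≤ (v : ℕ) ∧ (v : ℕ) ≤ 2 * x.2.1 + 1) ∨
      (2 * x.2.1 + 2 ≤ (v : ℕ) ∧ (v : ℕ) ≤ 2 * x.2.1 + 1)) := by
  rw [rowOf, dif_neg (by omega), dif_neg (by omega), dif_pos hs]; exact mem_genRow _ v

/-- Column `S2a(i) = T(2i, 2k)`. [folklore] -/
private theorem colOf_2a (hs : x.1 = 2 ∧ 1 ≤ x.2.1 ∧ x.2.1 + 1 ≤ k ∧ x.2.2 = 0) :
    (colOf m k hk x).p = 2 * x.2.1 ∧ (colOf m k hk x).p' = 2 * x.2.1 + 1 ∧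
      (colOf m k hk x).q = 2 * k ∧ (colOf m k hk x).q' = 2 * k + 1 := by
  rw [colOf, dif_neg (by omega), dif_neg (by omega), dif_pos hs]
  refine ⟨rfl, ?_, rfl, ?_⟩ <;> simp only [col] <;> omega

/-- Row `S2b(i,j) = {1} ∪ [2j+2, 2i+1]`. [folklore] -/
private theorem rowOf_2b (hs : x.1 = 2 ∧ 1 ≤ x.2.2 ∧ x.2.2 < x.2.1 ∧ x.2.1 ≤ k) (v : Fin (2 * m)) :
    v ∈ (rowOf m k hk x).1 ↔ ((v : ℕ) = 1 ∨ (2 * x.2.2 + 2 ≤ (v : ℕ) ∧ (v : ℕ) ≤ 2 * x.2.1 + 1) ∨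
      (2 * x.2.1 + 2 ≤ (v : ℕ) ∧ (v : ℕ) ≤ 2 * x.2.1 + 1) ∨
      (2 * x.2.1 + 2 ≤ (v : ℕ) ∧ (v : ℕ) ≤ 2 * x.2.1 + 1)) := by
  rw [rowOf, dif_neg (by omega), dif_neg (by omega), dif_neg (by omega), dif_pos hs]
  exact mem_genRow _ v

/-- Column `S2b(i,j) = T(2i, 2j)`. [folklore] -/
private theorem colOf_2b (hs : x.1 = 2 ∧ 1 ≤ x.2.2 ∧ x.2.2 < x.2.1 ∧ x.2.1 ≤ k) :
    (colOf m k hk x).p = 2 * x.2.1 ∧ (colOf m k hk x).p' = 2 * x.2.1 + 1 ∧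
      (colOf m k hk x).q = 2 * x.2.2 ∧ (colOf m k hk x).q' = 2 * x.2.2 + 1 := by
  rw [colOf, dif_neg (by omega), dif_neg (by omega), dif_neg (by omega), dif_pos hs]
  refine ⟨rfl, ?_, rfl, ?_⟩ <;> simp only [col] <;> omega

/-- Row `S3(b,a) = {1} ∪ [2, 2a−1] ∪ [2a+2, 2k+1] ∪ [2b, 2b+1]`. [folklore] -/
private theorem rowOf_3 (hs : x.1 = 3 ∧ k + 1 ≤ x.2.1 ∧ x.2.1 + 2 ≤ m ∧ 1 ≤ x.2.2 ∧ x.2.2 ≤ k)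
    (v : Fin (2 * m)) :
    v ∈ (rowOf m k hk x).1 ↔ ((v : ℕ) = 1 ∨ (2 ≤ (v : ℕ) ∧ (v : ℕ) ≤ 2 * x.2.2 - 1) ∨
      (2 * x.2.2 + 2 ≤ (v : ℕ) ∧ (v : ℕ) ≤ 2 * k + 1) ∨
      (2 * x.2.1 ≤ (v : ℕ) ∧ (v : ℕ) ≤ 2 * x.2.1 + 1)) := by
  rw [rowOf, dif_neg (by omega), dif_neg (by omega), dif_neg (by omega), dif_neg (by omega),
    dif_pos hs]
  exact mem_genRow _ v

/-- Column `S3(b,a) = T(2b, 2a)`. [folklore] -/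
private theorem colOf_3 (hs : x.1 = 3 ∧ k + 1 ≤ x.2.1 ∧ x.2.1 + 2 ≤ m ∧ 1 ≤ x.2.2 ∧ x.2.2 ≤ k) :
    (colOf m k hk x).p = 2 * x.2.1 ∧ (colOf m k hk x).p' = 2 * x.2.1 + 1 ∧
      (colOf m k hk x).q = 2 * x.2.2 ∧ (colOf m k hk x).q' = 2 * x.2.2 + 1 := by
  rw [colOf, dif_neg (by omega), dif_neg (by omega), dif_neg (by omega), dif_neg (by omega),
    dif_pos hs]
  refine ⟨rfl, ?_, rfl, ?_⟩ <;> simp only [col] <;> omega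

/-- Row `S4a(q) = {q−1, q, n−2}`. [folklore] -/
private theorem rowOf_4a (hs : x.1 = 4 ∧ x.2.1 % 2 = 1 ∧ 3 ≤ x.2.1 ∧ x.2.1 + 3 ≤ 2 * m ∧ x.2.2 = 0)
    (v : Fin (2 * m)) :
    v ∈ (rowOf m k hk x).1 ↔ ((v : ℕ) = x.2.1 - 1 ∨ (v : ℕ) = x.2.1 ∨ (v : ℕ) = 2 * m - 2) := by
  rw [rowOf, dif_neg (by omega), dif_neg (by omega), dif_neg (by omega), dif_neg (by omega),
    dif_neg (by omega), dif_pos hs]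
  exact mem_tri _ v

/-- Column `S4a(q) = T(n−2, q)`. [folklore] -/
private theorem colOf_4a (hs : x.1 = 4 ∧ x.2.1 % 2 = 1 ∧ 3 ≤ x.2.1 ∧ x.2.1 + 3 ≤ 2 * m ∧ x.2.2 = 0) :
    (colOf m k hk x).p = 2 * m - 2 ∧ (colOf m k hk x).p' = 2 * m - 1 ∧
      (colOf m k hk x).q = x.2.1 ∧ (colOf m k hk x).q' = x.2.1 - 1 := by
  rw [colOf, dif_neg (by omega), dif_neg (by omega), dif_neg (by omega), dif_neg (by omega),
    dif_neg (by omega), dif_pos hs]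
  refine ⟨rfl, ?_, rfl, ?_⟩ <;> simp only [col] <;> omega

/-- Row `S4b = {0, 2, n−1}`. [folklore] -/
private theorem rowOf_4b (hs : x.1 = 5 ∧ x.2.1 = 0 ∧ x.2.2 = 0) (v : Fin (2 * m)) :
    v ∈ (rowOf m k hk x).1 ↔ ((v : ℕ) = 0 ∨ (v : ℕ) = 2 ∨ (v : ℕ) = 2 * m - 1) := by
  rw [rowOf, dif_neg (by omega), dif_neg (by omega), dif_neg (by omega), dif_neg (by omega),
    dif_neg (by omega), dif_neg (by omega), dif_pos hs]
  exact mem_tri _ v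

/-- Column `S4b = T(n−2, n−1)`. [folklore] -/
private theorem colOf_4b (hs : x.1 = 5 ∧ x.2.1 = 0 ∧ x.2.2 = 0) :
    (colOf m k hk x).p = 2 * m - 2 ∧ (colOf m k hk x).p' = 2 * m - 1 ∧
      (colOf m k hk x).q = 2 * m - 1 ∧ (colOf m k hk x).q' = 2 * m - 2 := by
  rw [colOf, dif_neg (by omega), dif_neg (by omega), dif_neg (by omega), dif_neg (by omega),
    dif_neg (by omega), dif_neg (by omega), dif_pos hs]
  refine ⟨rfl, ?_, rfl, ?_⟩ <;> simp only [col] <;> omega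

/-- Row `S4c(q) = {1} ∪ [q+1, n−1]`. [folklore] -/
private theorem rowOf_4c (hs : x.1 = 6 ∧ x.2.1 % 2 = 1 ∧ 3 ≤ x.2.1 ∧ x.2.1 + 3 ≤ 2 * m ∧ x.2.2 = 0)
    (v : Fin (2 * m)) :
    v ∈ (rowOf m k hk x).1 ↔ ((v : ℕ) = 1 ∨ (x.2.1 + 1 ≤ (v : ℕ) ∧ (v : ℕ) ≤ 2 * m - 1) ∨
      (2 * m ≤ (v : ℕ) ∧ (v : ℕ) ≤ 2 * m - 1) ∨ (2 * m ≤ (v : ℕ) ∧ (v : ℕ) ≤ 2 * m - 1)) := by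
  rw [rowOf, dif_neg (by omega), dif_neg (by omega), dif_neg (by omega), dif_neg (by omega),
    dif_neg (by omega), dif_neg (by omega), dif_neg (by omega), dif_pos hs]
  exact mem_genRow _ v

/-- Column `S4c(q) = T(n−1, q)`. [folklore] -/
private theorem colOf_4c (hs : x.1 = 6 ∧ x.2.1 % 2 = 1 ∧ 3 ≤ x.2.1 ∧ x.2.1 + 3 ≤ 2 * m ∧ x.2.2 = 0) :
    (colOf m k hk x).p = 2 * m - 1 ∧ (colOf m k hk x).p' = 2 * m - 2 ∧
      (colOf m k hk x).q = x.2.1 ∧ (colOf m k hk x).q' = x.2.1 - 1 := by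
  rw [colOf, dif_neg (by omega), dif_neg (by omega), dif_neg (by omega), dif_neg (by omega),
    dif_neg (by omega), dif_neg (by omega), dif_neg (by omega), dif_pos hs]
  refine ⟨rfl, ?_, rfl, ?_⟩ <;> simp only [col] <;> omega

/-- Row `S4d = {0, 1, 2}`. [folklore] -/
private theorem rowOf_4d (hs : x.1 = 7 ∧ x.2.1 = 0 ∧ x.2.2 = 0) (v : Fin (2 * m)) :
    v ∈ (rowOf m k hk x).1 ↔ ((v : ℕ) = 0 ∨ (v : ℕ) = 1 ∨ (v : ℕ) = 2) := by
  rw [rowOf, dif_neg (by omega), dif_neg (by omega), dif_neg (by omega), dif_neg (by omega),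
    dif_neg (by omega), dif_neg (by omega), dif_neg (by omega), dif_neg (by omega)]
  exact mem_tri _ v

/-- Column `S4d = T(n−1, n−2)`. [folklore] -/
private theorem colOf_4d (hs : x.1 = 7 ∧ x.2.1 = 0 ∧ x.2.2 = 0) :
    (colOf m k hk x).p = 2 * m - 1 ∧ (colOf m k hk x).p' = 2 * m - 2 ∧
      (colOf m k hk x).q = 2 * m - 2 ∧ (colOf m k hk x).q' = 2 * m - 1 := by
  rw [colOf, dif_neg (by omega), dif_neg (by omega), dif_neg (by omega), dif_neg (by omega),
    dif_neg (by omega), dif_neg (by omega), dif_neg (by omega), dif_neg (by omega)]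
  refine ⟨rfl, ?_, rfl, ?_⟩ <;> simp only [col] <;> omega

/-- The data `(p, p̄, q, q̄)` of the column at an index, shape by shape. [folklore] -/
private theorem colOf_data (hx : x ∈ idx m k) :
    ((x.1 = 1 ∧ k ≤ x.2.1 ∧ x.2.1 + 2 ≤ m ∧ x.2.2 = 0) ∧ (colOf m k hk x).p = 2 * x.2.1 ∧
      (colOf m k hk x).p' = 2 * x.2.1 + 1 ∧ (colOf m k hk x).q = 2 * m - 1 ∧
      (colOf m k hk x).q' = 2 * m - 2) ∨
    ((x.1 = 1 ∧ k + 1 ≤ x.2.2 ∧ x.2.2 < x.2.1 ∧ x.2.1 + 2 ≤ m) ∧ (colOf m k hk x).p = 2 * x.2.1 ∧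
      (colOf m k hk x).p' = 2 * x.2.1 + 1 ∧ (colOf m k hk x).q = 2 * x.2.2 ∧
      (colOf m k hk x).q' = 2 * x.2.2 + 1) ∨
    ((x.1 = 2 ∧ 1 ≤ x.2.1 ∧ x.2.1 + 1 ≤ k ∧ x.2.2 = 0) ∧ (colOf m k hk x).p = 2 * x.2.1 ∧
      (colOf m k hk x).p' = 2 * x.2.1 + 1 ∧ (colOf m k hk x).q = 2 * k ∧
      (colOf m k hk x).q' = 2 * k + 1) ∨
    ((x.1 = 2 ∧ 1 ≤ x.2.2 ∧ x.2.2 < x.2.1 ∧ x.2.1 ≤ k) ∧ (colOf m k hk x).p = 2 * x.2.1 ∧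
      (colOf m k hk x).p' = 2 * x.2.1 + 1 ∧ (colOf m k hk x).q = 2 * x.2.2 ∧
      (colOf m k hk x).q' = 2 * x.2.2 + 1) ∨
    ((x.1 = 3 ∧ k + 1 ≤ x.2.1 ∧ x.2.1 + 2 ≤ m ∧ 1 ≤ x.2.2 ∧ x.2.2 ≤ k) ∧
      (colOf m k hk x).p = 2 * x.2.1 ∧ (colOf m k hk x).p' = 2 * x.2.1 + 1 ∧
      (colOf m k hk x).q = 2 * x.2.2 ∧ (colOf m k hk x).q' = 2 * x.2.2 + 1) ∨
    ((x.1 = 4 ∧ x.2.1 % 2 = 1 ∧ 3 ≤ x.2.1 ∧ x.2.1 + 3 ≤ 2 * m ∧ x.2.2 = 0) ∧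
      (colOf m k hk x).p = 2 * m - 2 ∧ (colOf m k hk x).p' = 2 * m - 1 ∧
      (colOf m k hk x).q = x.2.1 ∧ (colOf m k hk x).q' = x.2.1 - 1) ∨
    ((x.1 = 5 ∧ x.2.1 = 0 ∧ x.2.2 = 0) ∧ (colOf m k hk x).p = 2 * m - 2 ∧
      (colOf m k hk x).p' = 2 * m - 1 ∧ (colOf m k hk x).q = 2 * m - 1 ∧
      (colOf m k hk x).q' = 2 * m - 2) ∨
    ((x.1 = 6 ∧ x.2.1 % 2 = 1 ∧ 3 ≤ x.2.1 ∧ x.2.1 + 3 ≤ 2 * m ∧ x.2.2 = 0) ∧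
      (colOf m k hk x).p = 2 * m - 1 ∧ (colOf m k hk x).p' = 2 * m - 2 ∧
      (colOf m k hk x).q = x.2.1 ∧ (colOf m k hk x).q' = x.2.1 - 1) ∨
    ((x.1 = 7 ∧ x.2.1 = 0 ∧ x.2.2 = 0) ∧ (colOf m k hk x).p = 2 * m - 1 ∧
      (colOf m k hk x).p' = 2 * m - 2 ∧ (colOf m k hk x).q = 2 * m - 2 ∧
      (colOf m k hk x).q' = 2 * m - 1) := by
  rcases shape_of_mem hx with h | h | h | h | h | h | h | h | h
  · exact Or.inl ⟨h, colOf_1a hk h⟩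
  · exact Or.inr (Or.inl ⟨h, colOf_1b hk h⟩)
  · exact Or.inr (Or.inr (Or.inl ⟨h, colOf_2a hk h⟩))
  · exact Or.inr (Or.inr (Or.inr (Or.inl ⟨h, colOf_2b hk h⟩)))
  · exact Or.inr (Or.inr (Or.inr (Or.inr (Or.inl ⟨h, colOf_3 hk h⟩))))
  · exact Or.inr (Or.inr (Or.inr (Or.inr (Or.inr (Or.inl ⟨h, colOf_4a hk h⟩)))))
  · exact Or.inr (Or.inr (Or.inr (Or.inr (Or.inr (Or.inr (Or.inl ⟨h, colOf_4b hk h⟩))))))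
  · exact Or.inr (Or.inr (Or.inr (Or.inr (Or.inr (Or.inr (Or.inr (Or.inl ⟨h, colOf_4c hk h⟩)))))))
  · exact Or.inr (Or.inr (Or.inr (Or.inr (Or.inr (Or.inr (Or.inr (Or.inr ⟨h, colOf_4d hk h⟩)))))))

end Shapes

/-! ### §8 The two crossing-number facts of the pattern: diagonal `≥ 2`, above the diagonal `= 1` -/

section Pattern

variable (hk : 1 ≤ k ∧ k + 2 ≤ m) {x y : ℕ × ℕ × ℕ}

/-- **Diagonal of `P(m,k)`**: `|δ(U_x) ∩ T_x| ≥ 2`, so the slack is non-zero there. [cite: Rothvoss2017, §2 (PDF p. 5)] -/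
theorem two_le_cc_rowOf_colOf (hx : x ∈ idx m k) :
    2 ≤ cc (rowOf m k hk x) (colOf m k hk x).toPMatch := by
  rcases colOf_data hk hx with ⟨hsy, e1, e2, e3, e4⟩ | ⟨hsy, e1, e2, e3, e4⟩ | ⟨hsy, e1, e2, e3, e4⟩ | ⟨hsy, e1, e2, e3, e4⟩ | ⟨hsy, e1, e2, e3, e4⟩ | ⟨hsy, e1, e2, e3, e4⟩ | ⟨hsy, e1, e2, e3, e4⟩ | ⟨hsy, e1, e2, e3, e4⟩ | ⟨hsy, e1, e2, e3, e4⟩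
  · exact gen_two_le_cc _ _ (by unfold IvOK; omega) (rowOf_1a hk hsy) (by omega) (by omega)
  · exact gen_two_le_cc _ _ (by unfold IvOK; omega) (rowOf_1b hk hsy) (by omega) (by omega)
  · exact gen_two_le_cc _ _ (by unfold IvOK; omega) (rowOf_2a hk hsy) (by omega) (by omega)
  · exact gen_two_le_cc _ _ (by unfold IvOK; omega) (rowOf_2b hk hsy) (by omega) (by omega)
  · exact gen_two_le_cc _ _ (by unfold IvOK; omega) (rowOf_3 hk hsy) (by omega) (by omega)
  · exact two_le_cc_B _ _ (by omega) (rowOf_4a hk hsy) (by omega)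
  · exact two_le_cc_Y0 _ _ (by omega) (rowOf_4b hk hsy) (by omega)
  · exact gen_two_le_cc _ _ (by unfold IvOK; omega) (rowOf_4c hk hsy) (by omega) (by omega)
  · exact two_le_cc_X0 _ _ (by omega) (rowOf_4d hk hsy) (by omega)

set_option maxHeartbeats 400000 in -- 9 × 9 shape combinations, each an `omega` call on the case data
/-- **Above the diagonal of `P(m,k)`**: if `x` precedes `y` (smaller code) then the column `T_y` is
tight on the row `U_x`: `|δ(U_x) ∩ T_y| = 1`. Generic rows by the directed-cut formula, the three
special rows of the tail by their own case tables; shape combinations excluded by the order are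
discharged by `omega`. [cite: Rothvoss2017, §2 (PDF p. 5)] -/
theorem cc_rowOf_colOf_eq_one (hx : x ∈ idx m k) (hy : y ∈ idx m k) (hlt : code m x < code m y) :
    cc (rowOf m k hk x) (colOf m k hk y).toPMatch = 1 := by
  have hlex := lex_of_code_lt hk (shape_of_mem hx) (shape_of_mem hy) hlt
  rcases shape_of_mem hx with hsx | hsx | hsx | hsx | hsx | hsx | hsx | hsx | hsx
  · have hU := rowOf_1a hk hsx
    rcases colOf_data hk hy with ⟨hsy, e1, e2, e3, e4⟩ | ⟨hsy, e1, e2, e3, e4⟩ | ⟨hsy, e1, e2, e3, e4⟩ | ⟨hsy, e1, e2, e3, e4⟩ | ⟨hsy, e1, e2, e3, e4⟩ | ⟨hsy, e1, e2, e3, e4⟩ | ⟨hsy, e1, e2, e3, e4⟩ | ⟨hsy, e1, e2, e3, e4⟩ | ⟨hsy, e1, e2, e3, e4⟩ <;>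
      exact gen_cc_eq_one _ _ (by unfold IvOK; omega) hU (by omega) (by omega)
  · have hU := rowOf_1b hk hsx
    rcases colOf_data hk hy with ⟨hsy, e1, e2, e3, e4⟩ | ⟨hsy, e1, e2, e3, e4⟩ | ⟨hsy, e1, e2, e3, e4⟩ | ⟨hsy, e1, e2, e3, e4⟩ | ⟨hsy, e1, e2, e3, e4⟩ | ⟨hsy, e1, e2, e3, e4⟩ | ⟨hsy, e1, e2, e3, e4⟩ | ⟨hsy, e1, e2, e3, e4⟩ | ⟨hsy, e1, e2, e3, e4⟩ <;>
      exact gen_cc_eq_one _ _ (by unfold IvOK; omega) hU (by omega) (by omega)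
  · have hU := rowOf_2a hk hsx
    rcases colOf_data hk hy with ⟨hsy, e1, e2, e3, e4⟩ | ⟨hsy, e1, e2, e3, e4⟩ | ⟨hsy, e1, e2, e3, e4⟩ | ⟨hsy, e1, e2, e3, e4⟩ | ⟨hsy, e1, e2, e3, e4⟩ | ⟨hsy, e1, e2, e3, e4⟩ | ⟨hsy, e1, e2, e3, e4⟩ | ⟨hsy, e1, e2, e3, e4⟩ | ⟨hsy, e1, e2, e3, e4⟩ <;>
      exact gen_cc_eq_one _ _ (by unfold IvOK; omega) hU (by omega) (by omega)
  · have hU := rowOf_2b hk hsx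
    rcases colOf_data hk hy with ⟨hsy, e1, e2, e3, e4⟩ | ⟨hsy, e1, e2, e3, e4⟩ | ⟨hsy, e1, e2, e3, e4⟩ | ⟨hsy, e1, e2, e3, e4⟩ | ⟨hsy, e1, e2, e3, e4⟩ | ⟨hsy, e1, e2, e3, e4⟩ | ⟨hsy, e1, e2, e3, e4⟩ | ⟨hsy, e1, e2, e3, e4⟩ | ⟨hsy, e1, e2, e3, e4⟩ <;>
      exact gen_cc_eq_one _ _ (by unfold IvOK; omega) hU (by omega) (by omega)
  · have hU := rowOf_3 hk hsx
    rcases colOf_data hk hy with ⟨hsy, e1, e2, e3, e4⟩ | ⟨hsy, e1, e2, e3, e4⟩ | ⟨hsy, e1, e2, e3, e4⟩ | ⟨hsy, e1, e2, e3, e4⟩ | ⟨hsy, e1, e2, e3, e4⟩ | ⟨hsy, e1, e2, e3, e4⟩ | ⟨hsy, e1, e2, e3, e4⟩ | ⟨hsy, e1, e2, e3, e4⟩ | ⟨hsy, e1, e2, e3, e4⟩ <;>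
      exact gen_cc_eq_one _ _ (by unfold IvOK; omega) hU (by omega) (by omega)
  · have hU := rowOf_4a hk hsx
    rcases colOf_data hk hy with ⟨hsy, e1, e2, e3, e4⟩ | ⟨hsy, e1, e2, e3, e4⟩ | ⟨hsy, e1, e2, e3, e4⟩ | ⟨hsy, e1, e2, e3, e4⟩ | ⟨hsy, e1, e2, e3, e4⟩ | ⟨hsy, e1, e2, e3, e4⟩ | ⟨hsy, e1, e2, e3, e4⟩ | ⟨hsy, e1, e2, e3, e4⟩ | ⟨hsy, e1, e2, e3, e4⟩
    · exfalso; omega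
    · exfalso; omega
    · exfalso; omega
    · exfalso; omega
    · exfalso; omega
    · exact cc_rowB_colB _ _ (q' := y.2.1) (by omega) hU (by omega)
    · exact cc_rowB_colY0 _ _ (by omega) hU (by omega)
    · exact cc_rowB_colC _ _ (q' := y.2.1) (by omega) hU (by omega)
    · exact cc_rowB_colX0 _ _ (by omega) hU (by omega)
  · have hU := rowOf_4b hk hsx
    rcases colOf_data hk hy with ⟨hsy, e1, e2, e3, e4⟩ | ⟨hsy, e1, e2, e3, e4⟩ | ⟨hsy, e1, e2, e3, e4⟩ | ⟨hsy, e1, e2, e3, e4⟩ | ⟨hsy, e1, e2, e3, e4⟩ | ⟨hsy, e1, e2, e3, e4⟩ | ⟨hsy, e1, e2, e3, e4⟩ | ⟨hsy, e1, e2, e3, e4⟩ | ⟨hsy, e1, e2, e3, e4⟩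
    · exfalso; omega
    · exfalso; omega
    · exfalso; omega
    · exfalso; omega
    · exfalso; omega
    · exfalso; omega
    · exfalso; omega
    · exact cc_rowY0_colC _ _ (q' := y.2.1) (by omega) hU (by omega)
    · exact cc_rowY0_colX0 _ _ (by omega) hU (by omega)
  · have hU := rowOf_4c hk hsx
    rcases colOf_data hk hy with ⟨hsy, e1, e2, e3, e4⟩ | ⟨hsy, e1, e2, e3, e4⟩ | ⟨hsy, e1, e2, e3, e4⟩ | ⟨hsy, e1, e2, e3, e4⟩ | ⟨hsy, e1, e2, e3, e4⟩ | ⟨hsy, e1, e2, e3, e4⟩ | ⟨hsy, e1, e2, e3, e4⟩ | ⟨hsy, e1, e2, e3, e4⟩ | ⟨hsy, e1, e2, e3, e4⟩ <;>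
      exact gen_cc_eq_one _ _ (by unfold IvOK; omega) hU (by omega) (by omega)
  · rcases colOf_data hk hy with ⟨hsy, e1, e2, e3, e4⟩ | ⟨hsy, e1, e2, e3, e4⟩ | ⟨hsy, e1, e2, e3, e4⟩ | ⟨hsy, e1, e2, e3, e4⟩ | ⟨hsy, e1, e2, e3, e4⟩ | ⟨hsy, e1, e2, e3, e4⟩ | ⟨hsy, e1, e2, e3, e4⟩ | ⟨hsy, e1, e2, e3, e4⟩ | ⟨hsy, e1, e2, e3, e4⟩ <;>
      (exfalso; omega)

end Pattern

/-! ### §9 From a coded pattern to a `Fin`-indexed one; relabelling by `S_n` -/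

/-- A finite pattern indexed by a set with an injective `ℕ`-code (row `x` vanishes on every column
`y` of LARGER code) can be enumerated increasingly as a `Fin`-indexed triangular pattern.
[cite: FawziEtAl2015, Thm. 2.10 + Ex. 2.11 (p07)] -/
theorem exists_fin_pattern {ι κ σ : Type*} [Nonempty σ] {M : ι → κ → ℝ} (P : Finset σ)
    (code : σ → ℕ) (hinj : Set.InjOn code ↑P) (ρ : σ → ι) (γ : σ → κ)
    (hdiag : ∀ x ∈ P, M (ρ x) (γ x) ≠ 0)
    (hoff : ∀ x ∈ P, ∀ y ∈ P, code x < code y → M (ρ x) (γ y) = 0) :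
    ∃ f : Fin P.card → σ, (∀ a, f a ∈ P) ∧ (∀ a, M (ρ (f a)) (γ (f a)) ≠ 0) ∧
      ∀ a b, a < b → M (ρ (f a)) (γ (f b)) = 0 := by
  classical
  set T : Finset ℕ := P.image code with hT'
  have hT : T.card = P.card := card_image_of_injOn hinj
  let e : Fin P.card ↪o ℕ := T.orderEmbOfFin hT
  let dec : ℕ → σ := Function.invFunOn code ↑P
  have hdec : ∀ a, dec (e a) ∈ P ∧ code (dec (e a)) = e a := by
    intro a
    have ha : e a ∈ T := T.orderEmbOfFin_mem hT a
    obtain ⟨x, hx, hxe⟩ := mem_image.1 ha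
    have hex : ∃ x ∈ (↑P : Set σ), code x = e a := ⟨x, hx, hxe⟩
    exact ⟨Function.invFunOn_mem hex, Function.invFunOn_eq hex⟩
  refine ⟨fun a => dec (e a), fun a => (hdec a).1, fun a => hdiag _ (hdec a).1, fun a b hab => ?_⟩
  exact hoff _ (hdec a).1 _ (hdec b).1 (by rw [(hdec a).2, (hdec b).2]; exact e.strictMono hab)

/-! ### §10 Every genuine Edmonds row heads a maximum-size triangular pattern; rank of the factors -/

/-- The first row `U_{(1,k,0)} = {1, …, 2k+1}` has `2k + 1` elements. [folklore] -/
private theorem card_rowOf_first (hk : 1 ≤ k ∧ k + 2 ≤ m) : (rowOf m k hk (1, k, 0)).1.card = 2 * k + 1 := by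
  rw [rowOf, dif_pos (by dsimp only; omega), card_genRow]
  dsimp only
  omega

/-- `|P(m,k) ∖ {first}| = C(m+1,2) − 2`. [folklore] -/
private theorem card_erase_first (hk : 1 ≤ k ∧ k + 2 ≤ m) :
    ((idx m k).erase (1, k, 0)).card = (m + 1).choose 2 - 2 := by
  have h1 := card_erase_of_mem (first_mem hk)
  have h2 := card_idx hk
  omega

/-- **Every genuine row of `S_odd(K_{2m})` heads a triangular pattern of the sharp fooling size.** For `m ≥ 3`
and EVERY odd set `U` with `3 ≤ |U| ≤ 2m − 3` there is a triangular pattern of size `C(m+1,2) − 2` inside the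
columns where the row `U` vanishes (so `(U, ·)` followed by it is a triangular pattern of size `C(m+1,2) − 1`,
the size of `MatchingSlackPsdFoolingSetSharp`): `U` is a relabelling of the first row `{1, …, |U|}` of
`P(m, (|U|−1)/2)`. The companion `PsdRankBeyondFooling.exists_rowPattern_three` is the case `|U| = 3`.
[cite: FawziEtAl2015, Thm. 2.10 + Ex. 2.11 (p07); GouveiaRobinsonThomas2013, Prop. 2.6 (p06)] -/
theorem exists_rowPattern (U : OddSet (2 * m)) (h3 : 3 ≤ U.1.card) (h3' : U.1.card + 3 ≤ 2 * m) :
    ∃ (ρ : Fin ((m + 1).choose 2 - 2) → OddSet (2 * m)) (γ : Fin ((m + 1).choose 2 - 2) → PMatch (2 * m)),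
      (∀ b, pmOddCutSlack (2 * m) U (γ b) = 0) ∧ (∀ b, pmOddCutSlack (2 * m) (ρ b) (γ b) ≠ 0) ∧
        ∀ b b', b < b' → pmOddCutSlack (2 * m) (ρ b) (γ b') = 0 := by
  have hodd := U.2
  rw [Nat.odd_iff] at hodd
  set k := U.1.card / 2 with hkdef
  have hk : 1 ≤ k ∧ k + 2 ≤ m := by omega
  have hcard : (rowOf m k hk (1, k, 0)).1.card = U.1.card := by rw [card_rowOf_first]; omega
  obtain ⟨σ, hσ⟩ := exists_imgOdd_eq _ _ hcard
  set P := (idx m k).erase (1, k, 0) with hP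
  have hPsub : P ⊆ idx m k := erase_subset _ _
  obtain ⟨f, hfP, hfd, hfo⟩ := exists_fin_pattern (M := pmOddCutSlack (2 * m)) P (code m)
    ((code_injOn hk).mono (by exact_mod_cast hPsub)) (fun x => imgOdd σ (rowOf m k hk x))
    (fun x => imgPM σ (colOf m k hk x).toPMatch)
    (fun x hx h0 => by
      rw [pmOddCutSlack_img, pmOddCutSlack_eq_zero_iff] at h0
      have := two_le_cc_rowOf_colOf hk (hPsub hx)
      omega)
    (fun x hx y hy hxy => by
      rw [pmOddCutSlack_img, pmOddCutSlack_eq_zero_iff]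
      exact cc_rowOf_colOf_eq_one hk (hPsub hx) (hPsub hy) hxy)
  have hK := card_erase_first hk
  refine ⟨fun b => imgOdd σ (rowOf m k hk (f (Fin.cast hK.symm b))),
    fun b => imgPM σ (colOf m k hk (f (Fin.cast hK.symm b))).toPMatch, fun b => ?_,
    fun b => hfd _, fun b b' hbb' => hfo _ _ hbb'⟩
  rw [← hσ, pmOddCutSlack_img, pmOddCutSlack_eq_zero_iff]
  have hb := hfP (Fin.cast hK.symm b)
  exact cc_rowOf_colOf_eq_one hk (first_mem hk) (hPsub hb) (code_first_lt hk (hPsub hb) (ne_of_mem_erase hb))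

/-- **Compression on EVERY row.** In any psd factorisation `S = (tr(A_U B_M))` of the odd-cut slack matrix of
`K_{2m}` (`m ≥ 3`), every factor `A_U` of a genuine row (`3 ≤ |U| ≤ 2m − 3`) satisfies
`rank A_U + (C(m+1,2) − 2) ≤ size`; in particular all such factors have rank `≤ 2` in a factorisation of the
first non-excluded size `C(m+1,2)`. (Rows with `|U| ∈ {1, 2m−1}` are identically zero.)
[cite: GouveiaRobinsonThomas2013, Prop. 2.6 (p06); Prop. 3.2 (p07)] -/
theorem rank_rowFactor_add_le {K : ℕ} (A : OddSet (2 * m) → Matrix (Fin K) (Fin K) ℝ)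
    (B : PMatch (2 * m) → Matrix (Fin K) (Fin K) ℝ) (hA : ∀ i, (A i).PosSemidef) (hB : ∀ j, (B j).PosSemidef)
    (hM : ∀ i j, pmOddCutSlack (2 * m) i j = (A i * B j).trace) (U : OddSet (2 * m)) (h3 : 3 ≤ U.1.card)
    (h3' : U.1.card + 3 ≤ 2 * m) : (A U).rank + ((m + 1).choose 2 - 2) ≤ K := by
  obtain ⟨ρ, γ, h0, hd, ho⟩ := exists_rowPattern U h3 h3'
  exact rank_rowFactor_add_le_of_triangular A B hA hB hM U ρ γ h0 hd ho

/-- **Compression on every column** (from the companion's `exists_colPattern`): every column factor satisfies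
`rank B_M + (C(m+1,2) − 2) ≤ size`. [cite: GouveiaRobinsonThomas2013, Prop. 2.6 (p06); Prop. 3.2 (p07)] -/
theorem rank_colFactor_add_le (hm : 3 ≤ m) {K : ℕ} (A : OddSet (2 * m) → Matrix (Fin K) (Fin K) ℝ)
    (B : PMatch (2 * m) → Matrix (Fin K) (Fin K) ℝ) (hA : ∀ i, (A i).PosSemidef) (hB : ∀ j, (B j).PosSemidef)
    (hM : ∀ i j, pmOddCutSlack (2 * m) i j = (A i * B j).trace) (M : PMatch (2 * m)) :
    (B M).rank + ((m + 1).choose 2 - 2) ≤ K := by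
  obtain ⟨ρ, γ, h0, hd, ho⟩ := exists_colPattern hm M
  exact rank_colFactor_add_le_of_triangular A B hA hB hM M ρ γ h0 hd ho

/-- **All factors of a psd factorisation of size `C(m+1,2)` have rank `≤ 2`** (genuine rows and all columns;
`m ≥ 3`) — the structure left after the companion's `+1` theorem excludes size `C(m+1,2) − 1`.
[cite: GouveiaRobinsonThomas2013, Prop. 2.6 (p06); Prop. 3.2 (p07)] -/
theorem rank_factors_le_two (hm : 3 ≤ m) (A : OddSet (2 * m) → Matrix (Fin ((m + 1).choose 2)) (Fin ((m + 1).choose 2)) ℝ)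
    (B : PMatch (2 * m) → Matrix (Fin ((m + 1).choose 2)) (Fin ((m + 1).choose 2)) ℝ)
    (hA : ∀ i, (A i).PosSemidef) (hB : ∀ j, (B j).PosSemidef)
    (hM : ∀ i j, pmOddCutSlack (2 * m) i j = (A i * B j).trace) :
    (∀ U : OddSet (2 * m), 3 ≤ U.1.card → U.1.card + 3 ≤ 2 * m → (A U).rank ≤ 2) ∧
      ∀ M, (B M).rank ≤ 2 := by
  refine ⟨fun U h3 h3' => ?_, fun M => ?_⟩
  · have := rank_rowFactor_add_le A B hA hB hM U h3 h3'
    omega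
  · have := rank_colFactor_add_le hm A B hA hB hM M
    omega

/-! ### §11 The parity minor: triangles `{p̄, q̄, n−2}` against `T(p, q)`, `blk p < blk q ≤ m − 2`

Index `u = ((I', J'), ε, δ)` with `I' < J' < m − 2`: blocks `I = I' + 1 < J = J' + 1 ≤ m − 2`, labels
`p = 2I + ε`, `q = 2J + δ`, partners `p̄ = 2I + 1 − ε`, `q̄ = 2J + 1 − δ`. Row `{p̄, q̄, n−2}`, column
`T(p, q)`. The row is tight exactly at its own column (`p̄ ↔ q̄` inside, `n−2 → n−1` out); against any
other column of the family `n−2` and `p̄` both leave, and a triangle has `|δ(U) ∩ M| ∈ {1, 3}`. So on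
this square minor `S = 2 · (J − I)`, and `J − I` is invertible over `𝔽₂` in even dimension. -/

/-- Index type of the minor for `r = m − 2` usable blocks. [folklore] -/
abbrev MIdx (r : ℕ) : Type := {x : Fin r × Fin r // x.1 < x.2} × (Fin 2 × Fin 2)

/-- `|{(I', J') : I' < J' < r}| = C(r, 2)`. [folklore] -/
private theorem card_ltPairs (r : ℕ) : Fintype.card {x : Fin r × Fin r // x.1 < x.2} = r.choose 2 := by
  rw [Fintype.card_subtype]
  have h1 : (univ.filter (fun x : Fin r × Fin r => x.1 < x.2)).card =
      ∑ i : Fin r, (univ.filter (fun j : Fin r => i < j)).card := by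
    rw [card_filter, ← univ_product_univ, sum_product]
    refine sum_congr rfl fun i _ => ?_
    rw [card_filter]
  rw [h1]
  have h2 : ∀ i : Fin r, (univ.filter (fun j : Fin r => i < j)).card = r - 1 - i := by
    intro i
    rw [filter_lt_eq_Ioi, Fin.card_Ioi]
  simp_rw [h2]
  rw [Fin.sum_univ_eq_sum_range (fun i => r - 1 - i) r]
  have h3 := sum_range_reflect (fun i => i) r
  rw [h3, Nat.choose_two_right]
  have h4 := sum_range_id_mul_two r
  omega

/-- `|MIdx r| = 4 · C(r, 2)`. [folklore] -/
private theorem card_MIdx (r : ℕ) : Fintype.card (MIdx r) = 4 * r.choose 2 := by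
  rw [Fintype.card_prod, card_ltPairs, Fintype.card_prod, Fintype.card_fin]
  ring

/-- `(J − I)² = I` over `𝔽₂` in even dimension — the inverse certificate of the minor's support.
[cite: GouveiaRobinsonThomas2013, Ex. 2.3 (p05)] -/
theorem complId_mul_self {α : Type*} [Fintype α] [DecidableEq α] (h : Even (Fintype.card α)) :
    (Matrix.of fun a b : α => (((if a = b then 0 else 1 : ℕ) : ℕ) : ZMod 2)) *
      (Matrix.of fun a b : α => (((if a = b then 0 else 1 : ℕ) : ℕ) : ZMod 2)) = 1 := by
  ext a c
  rw [Matrix.mul_apply]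
  have hterm : ∀ b, (Matrix.of fun a b : α => (((if a = b then 0 else 1 : ℕ) : ℕ) : ZMod 2)) a b *
      (Matrix.of fun a b : α => (((if a = b then 0 else 1 : ℕ) : ℕ) : ZMod 2)) b c =
      if b ∉ ({a, c} : Finset α) then 1 else 0 := by
    intro b
    simp only [Matrix.of_apply, mem_insert, mem_singleton]
    by_cases h1 : a = b <;> by_cases h2 : b = c <;> simp [h1, h2, eq_comm]
  simp_rw [hterm]
  rw [Finset.sum_boole, Finset.filter_not, Finset.filter_mem_eq_inter, Finset.univ_inter,
    Finset.card_univ_sdiff, Matrix.one_apply]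
  by_cases hac : a = c
  · subst hac
    rw [if_pos rfl]
    have hc : ({a, a} : Finset α).card = 1 := by rw [Finset.pair_eq_singleton, card_singleton]
    rw [hc]
    have h1 : 1 ≤ Fintype.card α := Fintype.card_pos_iff.2 ⟨a⟩
    apply (ZMod.natCast_eq_one_iff_odd).2
    rcases h with ⟨t, ht⟩
    exact ⟨t - 1, by omega⟩
  · rw [if_neg hac, Finset.card_pair hac]
    have h2 : 2 ≤ Fintype.card α := by
      have : ({a, c} : Finset α).card ≤ Fintype.card α := Finset.card_le_univ _
      rwa [Finset.card_pair hac] at this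
    apply (ZMod.natCast_eq_zero_iff_even).2
    rcases h with ⟨t, ht⟩
    exact ⟨t - 1, by omega⟩

section MinorData

variable {r : ℕ}

/-- Label `p = 2I + ε` of the index. [folklore] -/
def mp (u : MIdx r) : ℕ := 2 * ((u.1.1.1 : ℕ) + 1) + u.2.1
/-- Label `q = 2J + δ` of the index. [folklore] -/
def mq (u : MIdx r) : ℕ := 2 * ((u.1.1.2 : ℕ) + 1) + u.2.2
/-- Partner `p̄ = 2I + 1 − ε`. [folklore] -/
def mpb (u : MIdx r) : ℕ := 2 * ((u.1.1.1 : ℕ) + 1) + (1 - u.2.1)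
/-- Partner `q̄ = 2J + 1 − δ`. [folklore] -/
def mqb (u : MIdx r) : ℕ := 2 * ((u.1.1.2 : ℕ) + 1) + (1 - u.2.2)

/-- Arithmetic of the labels of an index. [folklore] -/
private theorem mIdx_bounds (u : MIdx r) :
    2 ≤ mp u ∧ mp u ≤ 2 * r + 1 ∧ 2 ≤ mq u ∧ mq u ≤ 2 * r + 1 ∧ mp u / 2 < mq u / 2 ∧
      mpb u + 2 * (mp u % 2) = mp u + 1 ∧ mqb u + 2 * (mq u % 2) = mq u + 1 := by
  obtain ⟨⟨⟨i, j⟩, hij⟩, ε, δ⟩ := u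
  have hi := i.2; have hj := j.2; have he := ε.2; have hd := δ.2
  have hij' : (i : ℕ) < j := hij
  simp only [mp, mq, mpb, mqb]
  omega

/-- The labels `(p, q)` determine the index. [folklore] -/
private theorem mIdx_eq_of_labels {u v : MIdx r} (hp : mp u = mp v) (hq : mq u = mq v) : u = v := by
  obtain ⟨⟨⟨i, j⟩, hij⟩, ε, δ⟩ := u
  obtain ⟨⟨⟨i', j'⟩, hij'⟩, ε', δ'⟩ := v
  have he := ε.2; have hd := δ.2; have he' := ε'.2; have hd' := δ'.2
  simp only [mp, mq] at hp hq
  have h1 : (i : ℕ) = i' := by omega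
  have h2 : (j : ℕ) = j' := by omega
  have h3 : (ε : ℕ) = ε' := by omega
  have h4 : (δ : ℕ) = δ' := by omega
  have := Fin.ext h1; have := Fin.ext h2; have := Fin.ext h3; have := Fin.ext h4
  subst i'; subst j'; subst ε'; subst δ'
  rfl

/-- Row of the minor: the triangle `{p̄, q̄, n−2}`. [folklore] -/
def mrow (hr : r + 2 = m) (u : MIdx r) : OddSet (2 * m) :=
  (tri (2 * m) (mpb u) (mqb u) (2 * m - 2) (by have := mIdx_bounds u; omega)).toOdd

/-- Column of the minor: `T(p, q)`. [folklore] -/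
def mcol (hr : r + 2 = m) (u : MIdx r) : TriCol (2 * m) :=
  col (2 * m) (mp u) (mq u) (by have := mIdx_bounds u; omega)

/-- **The minor is `2 · (J − I)`**: `|δ({p̄_u, q̄_u, n−2}) ∩ T(p_v, q_v)| = 1` if `u = v`, else `3`.
[cite: Rothvoss2017, §2 (PDF p. 5)] -/
theorem cc_mrow_mcol (hr : r + 2 = m) (u v : MIdx r) :
    cc (mrow hr u) (mcol hr v).toPMatch = if u = v then 1 else 3 := by
  have hbu := mIdx_bounds u
  have hbv := mIdx_bounds v
  have e1 : (mcol hr v).p = mp v := rfl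
  have e2 : (mcol hr v).p' = mp v + 1 - 2 * (mp v % 2) := rfl
  have e3 : (mcol hr v).q = mq v := rfl
  have e4 : (mcol hr v).q' = mq v + 1 - 2 * (mq v % 2) := rfl
  have hU := mem_tri (n := 2 * m) (a := mpb u) (b := mqb u) (c := 2 * m - 2) (by omega)
  by_cases huv : u = v
  · subst huv
    rw [if_pos rfl]
    exact cc_minor_diag (mcol hr u) _ (p := mp u) (pb := mpb u) (q := mq u) (qb := mqb u)
      ⟨e1, by omega, e3, by omega⟩ hU (by omega)
  · rw [if_neg huv]
    have hne : (mcol hr v).p ≠ mp u ∨ (mcol hr v).q ≠ mq u := by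
      by_cases h1 : mp v = mp u
      · right
        intro h2
        exact huv (mIdx_eq_of_labels h1.symm (h2 : mq v = mq u).symm)
      · left; exact h1
    have h2 := two_le_cc_minor (mcol hr v) _ (p := mp u) (pb := mpb u) (q := mq u) (qb := mqb u) hU
      (by omega) (by omega) hne
    have h3 := cc_toOdd_add_two_mul
      (tri (2 * m) (mpb u) (mqb u) (2 * m - 2) (by have := mIdx_bounds u; omega)) (mcol hr v).toPMatch
    change 2 ≤ cc (mrow hr u) _ at h2
    change cc (mrow hr u) _ + _ = 3 at h3
    omega

/-- The slack entries on the minor: `S = 2 · (J − I)`. [cite: KaniewskiLeeDewolf2015, §7.3 (p. 12)] -/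
theorem pmOddCutSlack_mrow_mcol (hr : r + 2 = m) (u v : MIdx r) :
    pmOddCutSlack (2 * m) (mrow hr u) (mcol hr v).toPMatch = 2 * (((if u = v then 0 else 1 : ℕ) : ℕ) : ℝ) := by
  rw [pmOddCutSlack_apply, cc_mrow_mcol]
  split_ifs <;> push_cast <;> ring

end MinorData

/-- **Square-root rank of `S_odd(K_{2m})`: every real `N` with `N ∘ N = S` has rank `≥ 4·C(m−2, 2) = 2(m−2)(m−3)`**
(`N = √2 · Z` on the minor with `Z ≡ J − I (mod 2)`, `det Z` odd; the companion's minor `{1,p,q} × N(p,q)` gives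
`(m−1)(m−2)`). By [FawziEtAl2015, Prop. 6.2] this is a lower bound on the size of any psd factorisation of `S`
with rank-one factors. [cite: GouveiaRobinsonThomas2013, Ex. 2.3 (p05); FawziEtAl2015, Prop. 6.2 (p18)] -/
theorem le_rank_of_hadamardSqrt (N : Matrix (OddSet (2 * m)) (PMatch (2 * m)) ℝ)
    (hN : ∀ i j, N i j ^ 2 = pmOddCutSlack (2 * m) i j) : 4 * (m - 2).choose 2 ≤ N.rank := by
  classical
  rcases Nat.lt_or_ge m 2 with hm | hm
  · have e : m - 2 = 0 := by omega
    rw [e]; simp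
  have hr : (m - 2) + 2 = m := by omega
  rw [← card_MIdx]
  exact le_rank_of_hadamardSqrt_of_oddMinor' (M := pmOddCutSlack (2 * m)) (mrow hr)
    (fun a => (mcol hr a).toPMatch) (fun a b => if a = b then 0 else 1) (fun a b => by split_ifs <;> omega)
    2 (by norm_num) (fun a b => pmOddCutSlack_mrow_mcol hr a b)
    (Matrix.of fun a b : MIdx (m - 2) => (((if a = b then 0 else 1 : ℕ) : ℕ) : ZMod 2))
    (complId_mul_self (by rw [card_MIdx]; exact ⟨2 * (m - 2).choose 2, by ring⟩)) N hN

/-- **No rank-one psd factorisation of `S_odd(K_{2m})` below size `2(m−2)(m−3)`** (square-root rank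
`≥ 4·C(m−2,2)`): a psd factorisation all of whose factors have rank `≤ 1` has size `≥ 4·C(m−2,2)`.
[cite: FawziEtAl2015, Prop. 6.2 (p18); GouveiaRobinsonThomas2013, Lemma 2.4 (p05)] -/
theorem le_of_rankOne_psdFactorization {K : ℕ} (A : OddSet (2 * m) → Matrix (Fin K) (Fin K) ℝ)
    (B : PMatch (2 * m) → Matrix (Fin K) (Fin K) ℝ) (hA : ∀ i, (A i).PosSemidef ∧ (A i).rank ≤ 1)
    (hB : ∀ j, (B j).PosSemidef ∧ (B j).rank ≤ 1) (hM : ∀ i j, pmOddCutSlack (2 * m) i j = (A i * B j).trace) :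
    4 * (m - 2).choose 2 ≤ K := by
  obtain ⟨N, hN, hr⟩ := FawziEtAl2015_prop62_holds (OddSet (2 * m)) (PMatch (2 * m)) (pmOddCutSlack (2 * m)) K
    ⟨A, B, hA, hB, hM⟩
  exact le_trans (le_rank_of_hadamardSqrt N hN) hr

end PsdRowCompression

end Literature.Barriers.PneNP
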